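import Literature.NumberTheory.ConnesConsani2021.ProlateEigenvaluePolynomialDecay
import Literature.NumberTheory.ConnesConsani2021.SeriesRemainderParametricTail
import Mathlib.Analysis.Complex.Exponential
import Mathlib.Analysis.Complex.Trigonometric
import Mathlib.Analysis.Real.Pi.Bounds
import HarnessLib

/-!
# An explicit, hypothesis-free bound `|λ(n)| ≤ 4·(4π²)ⁿ/(n!)²` for the prolate eigenvalues, by moments

RH-FREE corpus literature (label, line 1): elementary real analysis of Slepian's prolate functions at
band-limit `c = 2π`; nothing in this file mentions `ζ`, the critical strip or RH, and nothing here
bears on the truth of RH.  bears_on (cell rh-crit, corpus C1): the FAR TAIL of the App. F remainder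
number `hRT` of the (E-a) panel frame (`ArchKernelL1Certificate.section6_enclosures_of_panels_of_majorant`),
route «ConnesConsaniSemilocal» item K3 `WindowSpectralBound` (stmt 19306).

## What is proved (theorems only; no definition, no named fact)

For the eigenvalues `λ(n)` (`prolateEigen n`) of the finite Fourier transform on the even prolate
functions `ψ_n = prolateFun n` (Connes–Consani 2021 §4 p. 16, (prolateeq)/(cosalphan)):

* **`abs_prolateEigen_le_explicit : ∀ n, |prolateEigen n| ≤ 4·(4π²)ⁿ/(n!)²`** — super-geometric decay
  with explicit constants, proved from scratch (no [Rokhlin–Xiao 2007], no [Osipov 2013]):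
  (i) the even MOMENTS `M_i = ∫_{−1}^{1} ψ_n(x)x^{2i}dx` satisfy, by the Green symmetry of the prolate
  operator against `x^{2i}` (`IsProlateFunction.eigen_mul_integral_mul_eq`, seat t7),
  `4π² M_{i+1} = (χ − 2i(2i+1)) M_i + 2i(2i−1) M_{i−1}`; (ii) Wang's window `χ_{2n} > 2n(2n+1)`
  (`IsProlateFunction.lt_eigen`) makes the recursion sign-preserving and expanding up to index `n`, so
  `|M_i|·Π_{l=i}^{n−1}(χ − 2l(2l+1))/(4π²) ≤ |M_n| ≤ 3/2`, whence `|M_i| ≤ (3/2)(2π²)^{n−i}/((2n+1)^{n−i}(n−i)!)`;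
  (iii) the cosine Taylor remainder `|cos y − Σ_{i<n}(−1)^i y^{2i}/(2i)!| ≤ 2|y|^{2n}/(2n)!`
  (Mathlib's `Complex.exp_bound'`, `|y| ≤ 2π`, `n ≥ 6`) in (cosalphan) `λ(n)ψ_n(ω) = ∫ψ_n(x)cos(2πxω)dx`
  at a point `ω₀` with `|ψ_n(ω₀)| ≥ ½` (`exists_half_le_abs_prolateFun`, seat t7) gives
  `|λ(n)|/2 ≤ Σ_{i<n}(2π)^{2i}/(2i)!·|M_i| + 3(2π)^{2n}/(2n)!`, and elementary factorial arithmetic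
  (`(2i)! ≥ 2^i(i!)²`, `n! ≤ i!(2n+1)^{n−i}`, `Σ C(n,i) = 2ⁿ`, `(2n)! ≥ 6(n!)²`) closes.
* the FAR TAIL numeral for the App. F remainder with this majorant:
  `Σ_{n ≥ 24} 4(4π²)ⁿ/(n!)²·4π·p(n) ≤ 1/2500` (`p = remainderPoly`; ratio `< 1/14` from `n = 24` on),
  and the HYBRID majorant package `fun n ↦ if n < 24 then R n else 4(4π²)ⁿ/(n!)²` turning any block of
  values `R(8), …, R(23)` (seat t15's index-wise bound, or certified enclosures) into the hypotheses
  `hR`, `hR'`, `hRs`, `hRT` of `section6_enclosures_of_panels_of_majorant` with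
  `T = Σ_{8≤n<24} R(n)·4πp(n) + 1/2500`.

* (§9–§11, appended) the un-simplified MOMENT-SUM form
  `|λ(n)| ≤ 3[Σ_{i<n}(2π)^{2i}/(2i)!·(2π²)^{n−i}/((n−i)!(2n+2i+1)^{n−i}) + 2(2π)^{2n}/(2n)!]` (`n ≥ 6`;
  `abs_prolateEigen_le_momentSum`, about `2ⁿ` sharper than the closed form), the analytic FAR TAIL FROM
  `n = 17` (`summable_farTail17_and_tsum_le`: `≤ 3/2000`, seven `norm_num` numerals + the tail from `24`),
  and the hybrid package with a general cut (`tsum_hybrid_le'`, `tsum_hybrid17_le`): a block source is then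
  needed only for `8 ≤ n ≤ 16`.

HONEST CAVEAT: both bounds are numerically useless below `n ≈ 16` (the closed form is `> 1` for
`n ≤ 15`; the printed (rapid-decay) display is `∼ (eπ/(4n))^{2n}`-sharp); their only job is the far tail.

Sources: A. Connes, C. Consani, *Weil positivity and trace formula, the archimedean place*, Selecta
Math. (N.S.) 27 (2021) 77 = arXiv:2006.13771 [bib `ConnesConsani2021`], §4 p. 16 eqs. (prolateeq),
(cosalphan), (rapid-decay); App. F Lemma F.1 (arXiv Lemma 49) p. 55.  L.-L. Wang, Math. Comp. 79 (2010)
Lemma 2.2 [bib `WangLL2010`].  The moment device is folklore (integration by parts against monomials).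
presearch: «explicit upper bound eigenvalues finite Fourier transform prolate, super-exponential decay» →
[corpus: paper:arxiv-1012.3881 (Bonami–Karoui, *Spectral decay of the sinc kernel operator…*, 2010) pp. 28–29]
explicit super-exponential decay of `λ_n(c)` by min-max against Legendre/Bessel expansions — ORDERING-based
(the `n`-th singular value), hence not index-wise without the ordering theorem; [corpus: arXiv:1206.4541
Thm 33 (Osipov 2013)] index-wise, Legendre-coefficient method, sharper constants, typed in the tree as
`Osipov2013_thm_33`; [corpus: book:hogan2011-duration-bandwidth-limiting pp. 33, 89] surveys both; galaxy
(pdf, needles «eigenvalues of the finite Fourier|prolate spheroidal»): no relevant hit.  The moment device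
below is elementary and self-contained; it is weaker than all of the above and claims no novelty.

WHAT THIS FILE IS NOT: a sharp decay estimate, a certificate, or anything about `ζ` or RH.
-/

noncomputable section

open Real Set MeasureTheory Filter Topology Finset

namespace Literature.NumberTheory.ConnesConsani2021

open Literature.NumberTheory.LFunctions

/-! ## §1 Moments of a prolate function: integrability, the bound `∫|ψ| ≤ 3/2` -/

/-- RH-FREE. `ψ_n · g` is interval-integrable on `[−1, 1]` for continuous `g`.
[cite: ConnesConsani2021, §4 p. 16 (arXiv p0016:L17–L28)] -/
theorem intervalIntegrable_prolateFun_mul (n : ℕ) {g : ℝ → ℝ} (hg : Continuous g) :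
    IntervalIntegrable (fun x ↦ prolateFun n x * g x) volume (-1) 1 :=
  ((isProlateFunction_prolateFun n).contDiffOn.continuousOn.mul hg.continuousOn).intervalIntegrable_of_Icc
    (by norm_num)

/-- RH-FREE. `∫_{−1}^{1} |ψ_n| ≤ 3/2` (`|ψ| ≤ (1 + ψ²)/2`, `∫ψ_n² = 1`).
[cite: ConnesConsani2021, §4 p. 16 (arXiv p0016:L17–L28); ConnesConsaniMoscovici2025, §7 eq. (7.12) (normalisation)] -/
theorem integral_abs_prolateFun_le (n : ℕ) : ∫ x in (-1 : ℝ)..1, |prolateFun n x| ≤ 3 / 2 := by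
  have hf := isProlateFunction_prolateFun n
  have hle : (-1 : ℝ) ≤ 1 := by norm_num
  have hfc : ContinuousOn (prolateFun n) (Icc (-1) 1) := hf.contDiffOn.continuousOn
  have hφi : IntervalIntegrable (fun x ↦ |prolateFun n x|) volume (-1) 1 :=
    hfc.abs.intervalIntegrable_of_Icc hle
  have hφ2i : IntervalIntegrable (fun x ↦ prolateFun n x ^ 2) volume (-1) 1 :=
    (hfc.pow 2).intervalIntegrable_of_Icc hle
  have hptw : ∀ x ∈ Icc (-1 : ℝ) 1, |prolateFun n x| ≤ (1 + prolateFun n x ^ 2) / 2 := by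
    intro x _
    have h0 : 0 ≤ (|prolateFun n x| - 1) ^ 2 := sq_nonneg _
    have h1 : |prolateFun n x| ^ 2 = prolateFun n x ^ 2 := sq_abs _
    nlinarith
  have hmono := intervalIntegral.integral_mono_on hle hφi
    ((intervalIntegrable_const.add hφ2i).div_const 2) hptw
  have hval : ∫ x in (-1 : ℝ)..1, (1 + prolateFun n x ^ 2) / 2 = 3 / 2 := by
    rw [intervalIntegral.integral_div, intervalIntegral.integral_add intervalIntegrable_const hφ2i,
      intervalIntegral.integral_const, hf.norm_one]
    norm_num
  linarith

/-- RH-FREE. The even moments are bounded: `|∫_{−1}^{1} ψ_n(x) x^{2i} dx| ≤ 3/2`.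
[cite: ConnesConsani2021, §4 p. 16 (arXiv p0016:L17–L28)] -/
theorem abs_moment_le_three_halves (n i : ℕ) :
    |∫ x in (-1 : ℝ)..1, prolateFun n x * x ^ (2 * i)| ≤ 3 / 2 := by
  have hle : (-1 : ℝ) ≤ 1 := by norm_num
  have hfc : ContinuousOn (prolateFun n) (Icc (-1) 1) :=
    (isProlateFunction_prolateFun n).contDiffOn.continuousOn
  have hi1 := intervalIntegrable_prolateFun_mul n (g := fun x ↦ x ^ (2 * i)) (by fun_prop)
  have hφi : IntervalIntegrable (fun x ↦ |prolateFun n x|) volume (-1) 1 :=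
    hfc.abs.intervalIntegrable_of_Icc hle
  calc |∫ x in (-1 : ℝ)..1, prolateFun n x * x ^ (2 * i)|
      ≤ ∫ x in (-1 : ℝ)..1, |prolateFun n x * x ^ (2 * i)| :=
        intervalIntegral.abs_integral_le_integral_abs hle
    _ ≤ ∫ x in (-1 : ℝ)..1, |prolateFun n x| := by
        refine intervalIntegral.integral_mono_on hle hi1.abs hφi fun x hx ↦ ?_
        rw [abs_mul]
        have hx1 : |x| ≤ 1 := abs_le.2 ⟨hx.1, hx.2⟩
        have hp : |x ^ (2 * i)| ≤ 1 := by
          rw [abs_pow]; exact pow_le_one₀ (abs_nonneg x) hx1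
        calc |prolateFun n x| * |x ^ (2 * i)| ≤ |prolateFun n x| * 1 :=
              mul_le_mul_of_nonneg_left hp (abs_nonneg _)
          _ = |prolateFun n x| := mul_one _
    _ ≤ 3 / 2 := integral_abs_prolateFun_le n

/-! ## §2 The Green recursion of the moments -/

/-- RH-FREE. **First moment identity**: `χ·∫ψ_n = 4π²·∫ψ_n x²` (Green symmetry against `g ≡ 1`).
[cite: ConnesConsani2021, §4 p. 16 eq. (prolateeq) (arXiv p0016:L17–L28); SlepianPollak1961, §III] -/
theorem eigen_mul_moment_zero (n : ℕ) {χ : ℝ}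
    (hχ : ∀ x ∈ Ioo (-1 : ℝ) 1,
      -(deriv (fun y ↦ ((1 : ℝ) ^ 2 - y ^ 2) * deriv (prolateFun n) y) x)
        + (2 * π * 1 * x) ^ 2 * prolateFun n x = χ * prolateFun n x) :
    χ * ∫ x in (-1 : ℝ)..1, prolateFun n x * x ^ (2 * 0)
      = 4 * π ^ 2 * ∫ x in (-1 : ℝ)..1, prolateFun n x * x ^ (2 * 1) := by
  have hf := isProlateFunction_prolateFun n
  have hG := hf.eigen_mul_integral_mul_eq hχ (g := fun _ ↦ (1 : ℝ)) (g₁ := fun _ ↦ 0)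
    (g₂ := fun _ ↦ 0) (fun x ↦ hasDerivAt_const x 1) (fun x ↦ hasDerivAt_const x 0) continuous_const
  have e1 : (fun x ↦ prolateFun n x * x ^ (2 * 0)) = fun x ↦ prolateFun n x * 1 := by
    funext x; simp
  rw [e1, hG, ← intervalIntegral.integral_const_mul]
  refine intervalIntegral.integral_congr fun x _ ↦ ?_
  ring

/-- RH-FREE. **The moment recursion** (Green symmetry against `g = x^{2j+2}`:
`L x^{2j+2} = −(2j+2)(2j+1)x^{2j} + (2j+2)(2j+3)x^{2j+2} + 4π²x^{2j+4}`):
`4π² M_{j+2} = (χ − (2j+2)(2j+3)) M_{j+1} + (2j+2)(2j+1) M_j`, `M_i = ∫_{−1}^{1}ψ_n x^{2i}`.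
[cite: ConnesConsani2021, §4 p. 16 eq. (prolateeq) (arXiv p0016:L17–L28); SlepianPollak1961, §III] -/
theorem four_pi_sq_mul_moment_add_two (n j : ℕ) {χ : ℝ}
    (hχ : ∀ x ∈ Ioo (-1 : ℝ) 1,
      -(deriv (fun y ↦ ((1 : ℝ) ^ 2 - y ^ 2) * deriv (prolateFun n) y) x)
        + (2 * π * 1 * x) ^ 2 * prolateFun n x = χ * prolateFun n x) :
    4 * π ^ 2 * ∫ x in (-1 : ℝ)..1, prolateFun n x * x ^ (2 * (j + 2))
      = (χ - (2 * j + 2) * (2 * j + 3)) * (∫ x in (-1 : ℝ)..1, prolateFun n x * x ^ (2 * (j + 1)))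
        + (2 * j + 2) * (2 * j + 1) * ∫ x in (-1 : ℝ)..1, prolateFun n x * x ^ (2 * j) := by
  have hf := isProlateFunction_prolateFun n
  -- the test function and its two derivatives
  have hg : ∀ x : ℝ, HasDerivAt (fun y : ℝ ↦ y ^ (2 * j + 2)) ((2 * j + 2 : ℝ) * x ^ (2 * j + 1)) x := by
    intro x
    have h := hasDerivAt_pow (2 * j + 2) x
    have hsub : 2 * j + 2 - 1 = 2 * j + 1 := by omega
    rw [hsub] at h
    refine h.congr_deriv ?_
    push_cast; ring
  have hg₁ : ∀ x : ℝ, HasDerivAt (fun y : ℝ ↦ (2 * j + 2 : ℝ) * y ^ (2 * j + 1))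
      ((2 * j + 2 : ℝ) * ((2 * j + 1 : ℝ) * x ^ (2 * j))) x := by
    intro x
    have h := hasDerivAt_pow (2 * j + 1) x
    have hsub : 2 * j + 1 - 1 = 2 * j := by omega
    rw [hsub] at h
    refine (h.const_mul (2 * j + 2 : ℝ)).congr_deriv ?_
    push_cast; ring
  have hG := hf.eigen_mul_integral_mul_eq hχ hg hg₁ (by fun_prop)
  -- rewrite both sides
  have e1 : (fun x ↦ prolateFun n x * x ^ (2 * (j + 1))) = fun x ↦ prolateFun n x * x ^ (2 * j + 2) := by
    funext x; ring_nf
  have hI0 := intervalIntegrable_prolateFun_mul n (g := fun x ↦ x ^ (2 * j)) (by fun_prop)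
  have hI1 := intervalIntegrable_prolateFun_mul n (g := fun x ↦ x ^ (2 * j + 2)) (by fun_prop)
  have hI2 := intervalIntegrable_prolateFun_mul n (g := fun x ↦ x ^ (2 * (j + 2))) (by fun_prop)
  -- the Green identity with the operator applied to `x^{2j+2}` expanded
  have hG' : χ * ∫ x in (-1 : ℝ)..1, prolateFun n x * x ^ (2 * j + 2)
      = ∫ x in (-1 : ℝ)..1, (-((2 * j + 2) * (2 * j + 1)) * (prolateFun n x * x ^ (2 * j))
          + ((2 * j + 2) * (2 * j + 3)) * (prolateFun n x * x ^ (2 * j + 2))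
          + 4 * π ^ 2 * (prolateFun n x * x ^ (2 * (j + 2)))) := by
    rw [hG]
    refine intervalIntegral.integral_congr fun x _ ↦ ?_
    ring
  rw [intervalIntegral.integral_add ((hI0.const_mul _).add (hI1.const_mul _)) (hI2.const_mul _),
    intervalIntegral.integral_add (hI0.const_mul _) (hI1.const_mul _),
    intervalIntegral.integral_const_mul, intervalIntegral.integral_const_mul,
    intervalIntegral.integral_const_mul] at hG'
  rw [e1]
  linarith

/-! ## §3 Sign and growth of a sequence obeying the recursion (abstract) -/

/-- RH-FREE. For a real sequence `N` with `N₀ ≥ 0`, `4π²N₁ = χN₀` and the moment recursion, and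
`χ > 2n(2n+1)`: `N_i ≥ 0` for all `i ≤ n + 1`. [cite: ConnesConsani2021, §4 p. 16 (arXiv p0016:L17–L36); WangLL2010, Lemma 2.2] -/
theorem momentRec_nonneg {N : ℕ → ℝ} {χ : ℝ} {n : ℕ} (hχn : 2 * (n : ℝ) * (2 * n + 1) < χ)
    (h0 : 0 ≤ N 0) (h1 : 4 * π ^ 2 * N 1 = χ * N 0)
    (hrec : ∀ j : ℕ, 4 * π ^ 2 * N (j + 2)
      = (χ - (2 * j + 2) * (2 * j + 3)) * N (j + 1) + (2 * j + 2) * (2 * j + 1) * N j) :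
    ∀ i, i ≤ n → 0 ≤ N i ∧ 0 ≤ N (i + 1) := by
  have hπ2 : 0 < 4 * π ^ 2 := by positivity
  have hχ0 : 0 < χ := lt_of_le_of_lt (by positivity) hχn
  intro i
  induction i with
  | zero =>
    intro _
    refine ⟨h0, ?_⟩
    have : 0 ≤ 4 * π ^ 2 * N 1 := by rw [h1]; exact mul_nonneg hχ0.le h0
    exact nonneg_of_mul_nonneg_right (by linarith) hπ2 |> fun h ↦ by nlinarith
  | succ i ih =>
    intro hi
    have ⟨hNi, hNi1⟩ := ih (by omega)
    refine ⟨hNi1, ?_⟩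
    have hi' : ((i : ℝ) + 1) ≤ n := by exact_mod_cast (show i + 1 ≤ n from hi)
    have hcoef : 0 ≤ χ - (2 * (i : ℝ) + 2) * (2 * i + 3) := by nlinarith
    have h := hrec i
    have : 0 ≤ 4 * π ^ 2 * N (i + 2) := by
      rw [h]
      exact add_nonneg (mul_nonneg hcoef hNi1) (mul_nonneg (by positivity) hNi)
    nlinarith

/-- RH-FREE. Growth step: for `i + 1 ≤ n`, `((χ − 2i(2i+1))/(4π²))·N_i ≤ N_{i+1}`.
[cite: ConnesConsani2021, §4 p. 16 (arXiv p0016:L17–L36); WangLL2010, Lemma 2.2] -/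
theorem momentRec_step {N : ℕ → ℝ} {χ : ℝ} {n : ℕ} (hχn : 2 * (n : ℝ) * (2 * n + 1) < χ)
    (h0 : 0 ≤ N 0) (h1 : 4 * π ^ 2 * N 1 = χ * N 0)
    (hrec : ∀ j : ℕ, 4 * π ^ 2 * N (j + 2)
      = (χ - (2 * j + 2) * (2 * j + 3)) * N (j + 1) + (2 * j + 2) * (2 * j + 1) * N j)
    {i : ℕ} (hi : i + 1 ≤ n) :
    (χ - 2 * (i : ℝ) * (2 * i + 1)) / (4 * π ^ 2) * N i ≤ N (i + 1) := by
  have hπ2 : 0 < 4 * π ^ 2 := by positivity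
  rw [div_mul_eq_mul_div, div_le_iff₀ hπ2]
  cases i with
  | zero => simp only [CharP.cast_eq_zero, mul_zero, zero_mul, sub_zero, zero_add]; rw [mul_comm (N 1), h1]
  | succ j =>
    have hNj : 0 ≤ N j := (momentRec_nonneg hχn h0 h1 hrec j (by omega)).1
    have h := hrec j
    have e : (χ - 2 * ((j + 1 : ℕ) : ℝ) * (2 * ((j + 1 : ℕ) : ℝ) + 1)) = χ - (2 * j + 2) * (2 * j + 3) := by
      push_cast; ring
    rw [e, show j + 1 + 1 = j + 2 from rfl, mul_comm (N (j + 2)), h]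
    nlinarith [mul_nonneg (by positivity : (0 : ℝ) ≤ (2 * j + 2) * (2 * j + 1)) hNj]

/-- RH-FREE. Growth chain: for `i + k ≤ n`, `N_i · Π_{s<k} (χ − 2(i+s)(2(i+s)+1))/(4π²) ≤ N_{i+k}`.
[cite: ConnesConsani2021, §4 p. 16 (arXiv p0016:L17–L36); WangLL2010, Lemma 2.2] -/
theorem momentRec_chain {N : ℕ → ℝ} {χ : ℝ} {n : ℕ} (hχn : 2 * (n : ℝ) * (2 * n + 1) < χ)
    (h0 : 0 ≤ N 0) (h1 : 4 * π ^ 2 * N 1 = χ * N 0)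
    (hrec : ∀ j : ℕ, 4 * π ^ 2 * N (j + 2)
      = (χ - (2 * j + 2) * (2 * j + 3)) * N (j + 1) + (2 * j + 2) * (2 * j + 1) * N j) :
    ∀ k i : ℕ, i + k ≤ n →
      N i * ∏ s ∈ range k, (χ - 2 * ((i + s : ℕ) : ℝ) * (2 * ((i + s : ℕ) : ℝ) + 1)) / (4 * π ^ 2)
        ≤ N (i + k) := by
  intro k
  induction k with
  | zero => intro i _; simp
  | succ k ih =>
    intro i hik
    have hπ2 : 0 < 4 * π ^ 2 := by positivity
    have hκ : 0 ≤ (χ - 2 * ((i + k : ℕ) : ℝ) * (2 * ((i + k : ℕ) : ℝ) + 1)) / (4 * π ^ 2) := by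
      refine div_nonneg ?_ hπ2.le
      have : ((i + k : ℕ) : ℝ) + 1 ≤ n := by exact_mod_cast (show i + k + 1 ≤ n by omega)
      nlinarith
    have hstep := momentRec_step hχn h0 h1 hrec (i := i + k) (by omega)
    rw [prod_range_succ, ← mul_assoc]
    calc N i * (∏ s ∈ range k, (χ - 2 * ((i + s : ℕ) : ℝ) * (2 * ((i + s : ℕ) : ℝ) + 1)) / (4 * π ^ 2))
          * ((χ - 2 * ((i + k : ℕ) : ℝ) * (2 * ((i + k : ℕ) : ℝ) + 1)) / (4 * π ^ 2))
        ≤ N (i + k) * ((χ - 2 * ((i + k : ℕ) : ℝ) * (2 * ((i + k : ℕ) : ℝ) + 1)) / (4 * π ^ 2)) :=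
          mul_le_mul_of_nonneg_right (ih i (by omega)) hκ
      _ ≤ N (i + k + 1) := by rw [mul_comm]; exact hstep
      _ = N (i + (k + 1)) := by rw [add_assoc]

/-- RH-FREE. The chain with the `χ`-free lower bounds of the factors: for `i + k ≤ n`,
`Π_{s<k} (χ − 2(i+s)(2(i+s)+1))/(4π²) ≥ Π_{s<k} 2(k−s)(2n+1)/(4π²) = ((2n+1)/(2π²))^k · k!`
(`2n(2n+1) − 2l(2l+1) = 2(n−l)(2n+2l+1) ≥ 2(n−l)(2n+1)`).
[cite: ConnesConsani2021, §4 p. 16 (arXiv p0016:L17–L36); WangLL2010, Lemma 2.2] -/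
theorem factorial_mul_pow_le_prod {χ : ℝ} {n : ℕ} (hχn : 2 * (n : ℝ) * (2 * n + 1) < χ) :
    ∀ k i : ℕ, i + k ≤ n →
      ((2 * (n : ℝ) + 1) / (2 * π ^ 2)) ^ k * (k.factorial : ℝ)
        ≤ ∏ s ∈ range k, (χ - 2 * ((i + s : ℕ) : ℝ) * (2 * ((i + s : ℕ) : ℝ) + 1)) / (4 * π ^ 2) := by
  have hπ2 : 0 < 4 * π ^ 2 := by positivity
  intro k
  induction k with
  | zero => intro i _; simp
  | succ k ih =>
    intro i hik
    -- split off the FIRST factor (`s = 0`, gap `n − i ≥ k + 1`) and shift the rest to `i + 1`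
    rw [prod_range_succ' (fun s ↦ (χ - 2 * ((i + s : ℕ) : ℝ) * (2 * ((i + s : ℕ) : ℝ) + 1)) / (4 * π ^ 2))]
    have hshift : ∏ s ∈ range k, (χ - 2 * ((i + (s + 1) : ℕ) : ℝ) * (2 * ((i + (s + 1) : ℕ) : ℝ) + 1))
          / (4 * π ^ 2)
        = ∏ s ∈ range k, (χ - 2 * ((i + 1 + s : ℕ) : ℝ) * (2 * ((i + 1 + s : ℕ) : ℝ) + 1)) / (4 * π ^ 2) := by
      refine prod_congr rfl fun s _ ↦ ?_
      rw [show i + (s + 1) = i + 1 + s by omega]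
    rw [hshift]
    have hIH := ih (i + 1) (by omega)
    -- the first factor dominates `(k+1)(2n+1)/(2π²)`
    have hi : ((i : ℝ) + (k + 1)) ≤ n := by exact_mod_cast (show i + (k + 1) ≤ n from hik)
    have hi0 : (0 : ℝ) ≤ i := Nat.cast_nonneg i
    have hfirst : (2 * (n : ℝ) + 1) / (2 * π ^ 2) * ((k : ℝ) + 1)
        ≤ (χ - 2 * ((i + 0 : ℕ) : ℝ) * (2 * ((i + 0 : ℕ) : ℝ) + 1)) / (4 * π ^ 2) := by
      rw [Nat.add_zero, div_mul_eq_mul_div, div_le_div_iff₀ (by positivity) hπ2]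
      -- `2(k+1)(2n+1) ≤ 2(n−i)(2n+2i+1) = 2n(2n+1) − 2i(2i+1) < χ − 2i(2i+1)`
      have hd : (0 : ℝ) ≤ (n : ℝ) - i - (k + 1) := by linarith
      have hcore : 2 * (2 * (n : ℝ) + 1) * ((k : ℝ) + 1) ≤ χ - 2 * (i : ℝ) * (2 * i + 1) := by
        nlinarith [mul_nonneg hd (by positivity : (0 : ℝ) ≤ 2 * n + 2 * i + 1),
          mul_nonneg (by positivity : (0 : ℝ) ≤ (k : ℝ) + 1) hi0]
      have h2π : (0 : ℝ) ≤ 2 * π ^ 2 := by positivity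
      nlinarith [mul_le_mul_of_nonneg_right hcore h2π]
    have hk0 : 0 ≤ ((2 * (n : ℝ) + 1) / (2 * π ^ 2)) ^ k * (k.factorial : ℝ) := by positivity
    have hf0 : 0 ≤ (2 * (n : ℝ) + 1) / (2 * π ^ 2) * ((k : ℝ) + 1) := by positivity
    calc ((2 * (n : ℝ) + 1) / (2 * π ^ 2)) ^ (k + 1) * ((k + 1).factorial : ℝ)
        = (((2 * (n : ℝ) + 1) / (2 * π ^ 2)) ^ k * (k.factorial : ℝ))
            * ((2 * (n : ℝ) + 1) / (2 * π ^ 2) * ((k : ℝ) + 1)) := by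
          rw [Nat.factorial_succ]; push_cast; ring
      _ ≤ (∏ s ∈ range k, (χ - 2 * ((i + 1 + s : ℕ) : ℝ) * (2 * ((i + 1 + s : ℕ) : ℝ) + 1)) / (4 * π ^ 2))
            * ((χ - 2 * ((i + 0 : ℕ) : ℝ) * (2 * ((i + 0 : ℕ) : ℝ) + 1)) / (4 * π ^ 2)) :=
          mul_le_mul hIH hfirst hf0 (hk0.trans hIH)

/-! ## §4 The moment bound -/

/-- RH-FREE. **The moment bound**: for `ψ_n` with eigenvalue `χ` (so `χ > 2n(2n+1)`) and `i + k = n`,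
`|∫_{−1}^{1} ψ_n(x) x^{2i} dx| ≤ (3/2)·(2π²)^k / ((2n+1)^k · k!)`.
[cite: ConnesConsani2021, §4 p. 16 (arXiv p0016:L17–L36); WangLL2010, Lemma 2.2] -/
theorem abs_moment_le (n i k : ℕ) (hik : i + k = n) :
    |∫ x in (-1 : ℝ)..1, prolateFun n x * x ^ (2 * i)|
      ≤ 3 / 2 * (2 * π ^ 2) ^ k / ((2 * (n : ℝ) + 1) ^ k * (k.factorial : ℝ)) := by
  have hf := isProlateFunction_prolateFun n
  obtain ⟨χ, hχ⟩ := hf.eigen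
  have hlt : ((2 * n : ℕ) : ℝ) * ((2 * n : ℕ) + 1) < χ := hf.lt_eigen hχ
  have hχn : 2 * (n : ℝ) * (2 * n + 1) < χ := by push_cast at hlt; linarith
  set M : ℕ → ℝ := fun i ↦ ∫ x in (-1 : ℝ)..1, prolateFun n x * x ^ (2 * i) with hM
  have hM1 : 4 * π ^ 2 * M 1 = χ * M 0 := (eigen_mul_moment_zero n hχ).symm
  have hMrec : ∀ j : ℕ, 4 * π ^ 2 * M (j + 2)
      = (χ - (2 * j + 2) * (2 * j + 3)) * M (j + 1) + (2 * j + 2) * (2 * j + 1) * M j :=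
    fun j ↦ four_pi_sq_mul_moment_add_two n j hχ
  -- sign-fixed sequence `N = ± M`
  have key : ∀ N : ℕ → ℝ, (N = M ∨ N = -M) → 0 ≤ N 0 →
      |M i| * ∏ s ∈ range k, (χ - 2 * ((i + s : ℕ) : ℝ) * (2 * ((i + s : ℕ) : ℝ) + 1)) / (4 * π ^ 2)
        ≤ |M n| := by
    intro N hN hN0
    have hN1 : 4 * π ^ 2 * N 1 = χ * N 0 := by
      rcases hN with rfl | rfl
      · exact hM1
      · simp only [Pi.neg_apply]; linarith
    have hNrec : ∀ j : ℕ, 4 * π ^ 2 * N (j + 2)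
        = (χ - (2 * j + 2) * (2 * j + 3)) * N (j + 1) + (2 * j + 2) * (2 * j + 1) * N j := by
      intro j
      rcases hN with rfl | rfl
      · exact hMrec j
      · simp only [Pi.neg_apply]; linarith [hMrec j]
    have hch := momentRec_chain hχn hN0 hN1 hNrec k i hik.le
    have hNi : 0 ≤ N i := (momentRec_nonneg hχn hN0 hN1 hNrec i (by omega)).1
    have habs_i : |M i| = N i := by
      rcases hN with rfl | rfl
      · exact abs_of_nonneg hNi
      · rw [Pi.neg_apply] at hNi ⊢; rw [abs_of_nonpos (by linarith)]
    have habs_n : N (i + k) ≤ |M n| := by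
      rw [hik]
      rcases hN with rfl | rfl
      · exact le_abs_self _
      · exact neg_le_abs _
    rw [habs_i]
    exact hch.trans habs_n
  have hprod : |M i| * ∏ s ∈ range k,
      (χ - 2 * ((i + s : ℕ) : ℝ) * (2 * ((i + s : ℕ) : ℝ) + 1)) / (4 * π ^ 2) ≤ |M n| := by
    rcases le_total 0 (M 0) with h | h
    · exact key M (Or.inl rfl) h
    · exact key (-M) (Or.inr rfl) (by simpa using h)
  -- combine with the χ-free lower bound of the product and `|M n| ≤ 3/2`
  have hlow := factorial_mul_pow_le_prod hχn k i hik.le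
  have hpos : 0 < ((2 * (n : ℝ) + 1) / (2 * π ^ 2)) ^ k * (k.factorial : ℝ) := by positivity
  have h32 : |M n| ≤ 3 / 2 := abs_moment_le_three_halves n n
  have h1 : |M i| * (((2 * (n : ℝ) + 1) / (2 * π ^ 2)) ^ k * (k.factorial : ℝ)) ≤ 3 / 2 :=
    ((mul_le_mul_of_nonneg_left hlow (abs_nonneg _)).trans hprod).trans h32
  rw [le_div_iff₀ (by positivity)]
  have e : ((2 * (n : ℝ) + 1) / (2 * π ^ 2)) ^ k * (k.factorial : ℝ) * (2 * π ^ 2) ^ k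
      = (2 * (n : ℝ) + 1) ^ k * (k.factorial : ℝ) := by
    rw [div_pow]; field_simp
  calc |M i| * ((2 * (n : ℝ) + 1) ^ k * (k.factorial : ℝ))
      = |M i| * (((2 * (n : ℝ) + 1) / (2 * π ^ 2)) ^ k * (k.factorial : ℝ)) * (2 * π ^ 2) ^ k := by
        rw [← e]; ring
    _ ≤ 3 / 2 * (2 * π ^ 2) ^ k := mul_le_mul_of_nonneg_right h1 (by positivity)


/-! ## §5 The cosine Taylor remainder (from Mathlib's `Complex.exp_bound'`) -/

/-- RH-FREE. Real part of the degree-`2n` Taylor polynomial of `exp(iy)`: the cosine Taylor polynomial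
`Σ_{i<n} (−1)^i y^{2i}/(2i)!`. [cite: ConnesConsani2021, §4 p. 16 eq. (prolateeq) (arXiv p0016:L17–L28) — the kernel `e^{2πixω}`] -/
theorem re_sum_range_two_mul_pow_mul_I (y : ℝ) (n : ℕ) :
    (∑ m ∈ range (2 * n), ((y : ℂ) * Complex.I) ^ m / (m.factorial : ℂ)).re
      = ∑ i ∈ range n, (-1) ^ i * y ^ (2 * i) / ((2 * i).factorial : ℝ) := by
  induction n with
  | zero => simp
  | succ n ih =>
    rw [show 2 * (n + 1) = 2 * n + 1 + 1 by ring, sum_range_succ, sum_range_succ, Complex.add_re,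
      Complex.add_re, ih, sum_range_succ]
    have he : (((y : ℂ) * Complex.I) ^ (2 * n) / ((2 * n).factorial : ℂ)).re
        = (-1) ^ n * y ^ (2 * n) / ((2 * n).factorial : ℝ) := by
      have h1 : ((y : ℂ) * Complex.I) ^ (2 * n) = (((-1) ^ n * y ^ (2 * n) : ℝ) : ℂ) := by
        rw [mul_pow, pow_mul, pow_mul, Complex.I_sq]; push_cast; ring
      rw [h1, ← Complex.ofReal_natCast, ← Complex.ofReal_div, Complex.ofReal_re]
    have ho : (((y : ℂ) * Complex.I) ^ (2 * n + 1) / ((2 * n + 1).factorial : ℂ)).re = 0 := by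
      have h1 : ((y : ℂ) * Complex.I) ^ (2 * n + 1)
          = (((-1) ^ n * y ^ (2 * n + 1) : ℝ) : ℂ) * Complex.I := by
        rw [pow_succ, mul_pow, pow_mul, pow_mul, Complex.I_sq]; push_cast; ring
      rw [h1, mul_div_right_comm, ← Complex.ofReal_natCast, ← Complex.ofReal_div,
        Complex.re_ofReal_mul, Complex.I_re, mul_zero]
    rw [he, ho, add_zero]

/-- RH-FREE. **Cosine Taylor remainder**: for `|y| ≤ (2n+1)/2`,
`|cos y − Σ_{i<n} (−1)^i y^{2i}/(2i)!| ≤ 2|y|^{2n}/(2n)!` (real part of `Complex.exp_bound'`).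
[cite: ConnesConsani2021, §4 p. 16 eq. (prolateeq) (arXiv p0016:L17–L28) — applied below to the kernel `cos(2πxω)`] -/
theorem abs_cos_sub_taylor_le (y : ℝ) (n : ℕ) (hy : |y| ≤ (2 * (n : ℝ) + 1) / 2) :
    |Real.cos y - ∑ i ∈ range n, (-1) ^ i * y ^ (2 * i) / ((2 * i).factorial : ℝ)|
      ≤ 2 * |y| ^ (2 * n) / ((2 * n).factorial : ℝ) := by
  have hnorm : ‖(y : ℂ) * Complex.I‖ = |y| := by
    rw [norm_mul, Complex.norm_I, mul_one, Complex.norm_real, Real.norm_eq_abs]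
  have hx : ‖(y : ℂ) * Complex.I‖ / ((2 * n).succ : ℝ) ≤ 1 / 2 := by
    rw [hnorm, div_le_iff₀ (by positivity)]
    push_cast
    linarith
  have h := Complex.exp_bound' (x := (y : ℂ) * Complex.I) (n := 2 * n) hx
  have hre : (Complex.exp ((y : ℂ) * Complex.I)
      - ∑ m ∈ range (2 * n), ((y : ℂ) * Complex.I) ^ m / (m.factorial : ℂ)).re
        = Real.cos y - ∑ i ∈ range n, (-1) ^ i * y ^ (2 * i) / ((2 * i).factorial : ℝ) := by
    rw [Complex.sub_re, Complex.exp_ofReal_mul_I_re, re_sum_range_two_mul_pow_mul_I]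
  rw [← hre]
  calc |(Complex.exp ((y : ℂ) * Complex.I)
          - ∑ m ∈ range (2 * n), ((y : ℂ) * Complex.I) ^ m / (m.factorial : ℂ)).re|
      ≤ ‖Complex.exp ((y : ℂ) * Complex.I)
          - ∑ m ∈ range (2 * n), ((y : ℂ) * Complex.I) ^ m / (m.factorial : ℂ)‖ :=
        Complex.abs_re_le_norm _
    _ ≤ ‖(y : ℂ) * Complex.I‖ ^ (2 * n) / ((2 * n).factorial : ℝ) * 2 := h
    _ = 2 * |y| ^ (2 * n) / ((2 * n).factorial : ℝ) := by rw [hnorm]; ring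

/-! ## §6 Factorial arithmetic -/

/-- RH-FREE. `2^i (i!)² ≤ (2i)!` (the central binomial coefficient is `≥ 2^i`). [folklore]
[cite: ConnesConsani2021, §4 p. 16 eq. (rapid-decay) (arXiv p0016:L34–L37) — factorial bookkeeping of the same kind] -/
theorem two_pow_mul_factorial_sq_le (i : ℕ) : 2 ^ i * i.factorial ^ 2 ≤ (2 * i).factorial := by
  induction i with
  | zero => simp
  | succ i ih =>
    rw [show 2 * (i + 1) = 2 * i + 1 + 1 by ring, Nat.factorial_succ (2 * i + 1),
      Nat.factorial_succ (2 * i), Nat.factorial_succ i]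
    have h1 : 2 * (i + 1) ^ 2 ≤ (2 * i + 1 + 1) * (2 * i + 1) := by nlinarith
    calc 2 ^ (i + 1) * ((i + 1) * i.factorial) ^ 2
        = (2 * (i + 1) ^ 2) * (2 ^ i * i.factorial ^ 2) := by ring
      _ ≤ ((2 * i + 1 + 1) * (2 * i + 1)) * (2 * i).factorial := Nat.mul_le_mul h1 ih
      _ = (2 * i + 1 + 1) * ((2 * i + 1) * (2 * i).factorial) := by ring

/-- RH-FREE. `n! ≤ i!·(2n+1)^{n−i}` for `i ≤ n` (`n!/i! = n(n−1)⋯(i+1) ≤ n^{n−i}`). [folklore]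
[cite: ConnesConsani2021, §4 p. 16 eq. (rapid-decay) (arXiv p0016:L34–L37) — factorial bookkeeping of the same kind] -/
theorem factorial_le_factorial_mul_pow {i n : ℕ} (h : i ≤ n) :
    n.factorial ≤ i.factorial * (2 * n + 1) ^ (n - i) := by
  have h1 := Nat.factorial_mul_descFactorial (n := n) (k := n - i) (Nat.sub_le n i)
  rw [Nat.sub_sub_self h] at h1
  rw [← h1]
  refine Nat.mul_le_mul_left _ ((Nat.descFactorial_le_pow n (n - i)).trans ?_)
  exact Nat.pow_le_pow_left (by omega) _

/-- RH-FREE. `6 (n!)² ≤ (2n)!` for `n ≥ 3`. [folklore]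
[cite: ConnesConsani2021, §4 p. 16 eq. (rapid-decay) (arXiv p0016:L34–L37) — factorial bookkeeping of the same kind] -/
theorem six_mul_factorial_sq_le {n : ℕ} (hn : 3 ≤ n) : 6 * n.factorial ^ 2 ≤ (2 * n).factorial := by
  induction n, hn using Nat.le_induction with
  | base => decide
  | succ n hn ih =>
    rw [show 2 * (n + 1) = 2 * n + 1 + 1 by ring, Nat.factorial_succ (2 * n + 1),
      Nat.factorial_succ (2 * n), Nat.factorial_succ n]
    have h1 : (n + 1) ^ 2 ≤ (2 * n + 1 + 1) * (2 * n + 1) := by nlinarith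
    calc 6 * ((n + 1) * n.factorial) ^ 2 = (n + 1) ^ 2 * (6 * n.factorial ^ 2) := by ring
      _ ≤ ((2 * n + 1 + 1) * (2 * n + 1)) * (2 * n).factorial := Nat.mul_le_mul h1 ih
      _ = (2 * n + 1 + 1) * ((2 * n + 1) * (2 * n).factorial) := by ring

/-- RH-FREE. The combination used termwise: for `n = i + k`,
`2ⁿ (n!)² ≤ C(n,i) · (2i)! · 2^k · (2n+1)^k · k!`. [folklore]
[cite: ConnesConsani2021, §4 p. 16 eq. (rapid-decay) (arXiv p0016:L34–L37) — factorial bookkeeping of the same kind] -/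
theorem two_pow_mul_factorial_sq_le_choose_mul (i k : ℕ) :
    2 ^ (i + k) * (i + k).factorial ^ 2
      ≤ (i + k).choose i * (2 * i).factorial * (2 ^ k * (2 * (i + k) + 1) ^ k * k.factorial) := by
  have hc : (i + k).choose i * i.factorial * k.factorial = (i + k).factorial := by
    have := Nat.choose_mul_factorial_mul_factorial (Nat.le_add_right i k)
    rwa [Nat.add_sub_cancel_left] at this
  have hf : (i + k).factorial ≤ i.factorial * (2 * (i + k) + 1) ^ k := by
    have := factorial_le_factorial_mul_pow (Nat.le_add_right i k)
    rwa [Nat.add_sub_cancel_left] at this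
  have h2 := two_pow_mul_factorial_sq_le i
  calc 2 ^ (i + k) * (i + k).factorial ^ 2
      = 2 ^ k * (2 ^ i * ((i + k).factorial * (i + k).factorial)) := by rw [pow_add]; ring
    _ ≤ 2 ^ k * (2 ^ i * (((i + k).choose i * i.factorial * k.factorial)
          * (i.factorial * (2 * (i + k) + 1) ^ k))) := by
        rw [hc]; exact Nat.mul_le_mul_left _ (Nat.mul_le_mul_left _ (Nat.mul_le_mul_left _ hf))
    _ = (2 ^ i * i.factorial ^ 2) * ((i + k).choose i * (2 ^ k * (2 * (i + k) + 1) ^ k * k.factorial)) := by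
        ring
    _ ≤ (2 * i).factorial * ((i + k).choose i * (2 ^ k * (2 * (i + k) + 1) ^ k * k.factorial)) :=
        Nat.mul_le_mul_right _ h2
    _ = (i + k).choose i * (2 * i).factorial * (2 ^ k * (2 * (i + k) + 1) ^ k * k.factorial) := by ring

/-- RH-FREE. Termwise bound (real form): for `n = i + k`,
`(2π)^{2i}/(2i)! · (3/2)(2π²)^k/((2n+1)^k k!) ≤ (3/2)(4π²)ⁿ·C(n,i)/(2ⁿ(n!)²)`.
[cite: ConnesConsani2021, §4 p. 16 eqs. (prolateeq), (rapid-decay) (arXiv p0016:L17–L37)] -/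
theorem taylor_mul_moment_term_le (i k : ℕ) :
    (2 * π) ^ (2 * i) / ((2 * i).factorial : ℝ)
        * (3 / 2 * (2 * π ^ 2) ^ k / ((2 * ((i + k : ℕ) : ℝ) + 1) ^ k * (k.factorial : ℝ)))
      ≤ 3 / 2 * (4 * π ^ 2) ^ (i + k) * ((i + k).choose i : ℝ)
          / (2 ^ (i + k) * ((i + k).factorial : ℝ) ^ 2) := by
  have hN := two_pow_mul_factorial_sq_le_choose_mul i k
  have hN' : (2 : ℝ) ^ (i + k) * ((i + k).factorial : ℝ) ^ 2
      ≤ ((i + k).choose i : ℝ) * ((2 * i).factorial : ℝ)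
          * (2 ^ k * (2 * ((i + k : ℕ) : ℝ) + 1) ^ k * (k.factorial : ℝ)) := by
    exact_mod_cast hN
  have hD : (0 : ℝ) < ((2 * i).factorial : ℝ) * (2 ^ k * (2 * ((i + k : ℕ) : ℝ) + 1) ^ k
      * (k.factorial : ℝ)) := by positivity
  have hE : (0 : ℝ) < 2 ^ (i + k) * ((i + k).factorial : ℝ) ^ 2 := by positivity
  -- rewrite the left side as `(3/2)(4π²)^{i+k} / D`
  have hpow : (2 * π) ^ (2 * i) * (2 * π ^ 2) ^ k * 2 ^ k = (4 * π ^ 2) ^ (i + k) := by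
    rw [mul_assoc, ← mul_pow, pow_add, pow_mul]; ring
  have eL : (2 * π) ^ (2 * i) / ((2 * i).factorial : ℝ)
        * (3 / 2 * (2 * π ^ 2) ^ k / ((2 * ((i + k : ℕ) : ℝ) + 1) ^ k * (k.factorial : ℝ)))
      = 3 / 2 * (4 * π ^ 2) ^ (i + k)
        / (((2 * i).factorial : ℝ) * (2 ^ k * (2 * ((i + k : ℕ) : ℝ) + 1) ^ k * (k.factorial : ℝ))) := by
    rw [← hpow]
    field_simp
  rw [eL, div_le_div_iff₀ hD hE]
  have h0 : (0 : ℝ) ≤ 3 / 2 * (4 * π ^ 2) ^ (i + k) := by positivity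
  calc 3 / 2 * (4 * π ^ 2) ^ (i + k) * (2 ^ (i + k) * ((i + k).factorial : ℝ) ^ 2)
      ≤ 3 / 2 * (4 * π ^ 2) ^ (i + k) * (((i + k).choose i : ℝ) * ((2 * i).factorial : ℝ)
          * (2 ^ k * (2 * ((i + k : ℕ) : ℝ) + 1) ^ k * (k.factorial : ℝ))) :=
        mul_le_mul_of_nonneg_left hN' h0
    _ = 3 / 2 * (4 * π ^ 2) ^ (i + k) * ((i + k).choose i : ℝ)
          * (((2 * i).factorial : ℝ) * (2 ^ k * (2 * ((i + k : ℕ) : ℝ) + 1) ^ k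
          * (k.factorial : ℝ))) := by ring

/-! ## §7 The explicit bound -/

/-- RH-FREE. **`|λ(n)| ≤ 4·(4π²)ⁿ/(n!)²` for `n ≥ 6`** (moments + cosine Taylor remainder at a point
where `|ψ_n| ≥ ½`). [cite: ConnesConsani2021, §4 p. 16 eqs. (prolateeq), (cosalphan), (rapid-decay) (arXiv p0016:L17–L37); WangLL2010, Lemma 2.2] -/
theorem abs_prolateEigen_le_of_six_le {n : ℕ} (hn : 6 ≤ n) :
    |prolateEigen n| ≤ 4 * (4 * π ^ 2) ^ n / (n.factorial : ℝ) ^ 2 := by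
  have hf := isProlateFunction_prolateFun n
  have hle : (-1 : ℝ) ≤ 1 := by norm_num
  obtain ⟨ω, hω, hφω⟩ := exists_half_le_abs_prolateFun n
  have hω1 : |ω| ≤ 1 := abs_le.2 ⟨hω.1, hω.2⟩
  -- (cosalphan) at `ω`
  have hcos : ∫ x in (-1 : ℝ)..1, prolateFun n x * Real.cos (2 * π * x * ω)
      = prolateEigen n * prolateFun n ω := by
    rw [prolateEigen_eq_intervalIntegral]; exact hf.integral_mul_cos_eq_mul hω
  -- the Taylor polynomial against `ψ_n`: a combination of moments
  set c : ℕ → ℝ := fun i ↦ (-1) ^ i * (2 * π * ω) ^ (2 * i) / ((2 * i).factorial : ℝ) with hc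
  have hP : ∀ x : ℝ, ∑ i ∈ range n, (-1) ^ i * (2 * π * x * ω) ^ (2 * i) / ((2 * i).factorial : ℝ)
      = ∑ i ∈ range n, c i * x ^ (2 * i) := by
    intro x
    refine sum_congr rfl fun i _ ↦ ?_
    rw [hc, show 2 * π * x * ω = (2 * π * ω) * x by ring, mul_pow]
    ring
  have hPc : Continuous fun x : ℝ ↦ ∑ i ∈ range n, c i * x ^ (2 * i) :=
    continuous_finsetSum _ fun i _ ↦ by fun_prop
  have hIP := intervalIntegrable_prolateFun_mul n hPc
  have hIcos := intervalIntegrable_prolateFun_mul n (g := fun x ↦ Real.cos (2 * π * x * ω)) (by fun_prop)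
  have hint_P : ∫ x in (-1 : ℝ)..1, prolateFun n x * ∑ i ∈ range n, c i * x ^ (2 * i)
      = ∑ i ∈ range n, c i * ∫ x in (-1 : ℝ)..1, prolateFun n x * x ^ (2 * i) := by
    have e : (fun x ↦ prolateFun n x * ∑ i ∈ range n, c i * x ^ (2 * i))
        = fun x ↦ ∑ i ∈ range n, c i * (prolateFun n x * x ^ (2 * i)) := by
      funext x; rw [mul_sum]; exact sum_congr rfl fun i _ ↦ by ring
    rw [e, intervalIntegral.integral_finsetSum fun i _ ↦
      (intervalIntegrable_prolateFun_mul n (g := fun x ↦ x ^ (2 * i)) (by fun_prop)).const_mul (c i)]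
    exact sum_congr rfl fun i _ ↦ intervalIntegral.integral_const_mul _ _
  -- (a) the remainder: `|∫ ψ (cos − P)| ≤ 3 (2π)^{2n}/(2n)!`
  have hrem : |(∫ x in (-1 : ℝ)..1, prolateFun n x * Real.cos (2 * π * x * ω))
      - ∫ x in (-1 : ℝ)..1, prolateFun n x * ∑ i ∈ range n, c i * x ^ (2 * i)|
        ≤ 3 * (2 * π) ^ (2 * n) / ((2 * n).factorial : ℝ) := by
    rw [← intervalIntegral.integral_sub hIcos hIP]
    have hφi : IntervalIntegrable (fun x ↦ |prolateFun n x|) volume (-1) 1 :=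
      hf.contDiffOn.continuousOn.abs.intervalIntegrable_of_Icc hle
    have hK : 0 ≤ 2 * (2 * π) ^ (2 * n) / ((2 * n).factorial : ℝ) := by positivity
    calc |∫ x in (-1 : ℝ)..1, (prolateFun n x * Real.cos (2 * π * x * ω)
            - prolateFun n x * ∑ i ∈ range n, c i * x ^ (2 * i))|
        ≤ ∫ x in (-1 : ℝ)..1, |prolateFun n x * Real.cos (2 * π * x * ω)
            - prolateFun n x * ∑ i ∈ range n, c i * x ^ (2 * i)| :=
          intervalIntegral.abs_integral_le_integral_abs hle
      _ ≤ ∫ x in (-1 : ℝ)..1, 2 * (2 * π) ^ (2 * n) / ((2 * n).factorial : ℝ) * |prolateFun n x| := by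
          refine intervalIntegral.integral_mono_on hle (hIcos.sub hIP).abs (hφi.const_mul _)
            fun x hx ↦ ?_
          rw [← mul_sub, abs_mul, mul_comm, ← hP x]
          refine mul_le_mul_of_nonneg_right ?_ (abs_nonneg _)
          have hx1 : |x| ≤ 1 := abs_le.2 ⟨hx.1, hx.2⟩
          have hy : |2 * π * x * ω| ≤ 2 * π := by
            rw [abs_mul, abs_mul, abs_of_pos (by positivity : (0 : ℝ) < 2 * π)]
            calc 2 * π * |x| * |ω| ≤ 2 * π * 1 * 1 := by gcongr
              _ = 2 * π := by ring
          have hyn : |2 * π * x * ω| ≤ (2 * (n : ℝ) + 1) / 2 := by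
            have : (6 : ℝ) ≤ n := by exact_mod_cast hn
            linarith [Real.pi_lt_d2]
          refine (abs_cos_sub_taylor_le _ n hyn).trans ?_
          rw [mul_div_assoc, mul_div_assoc]
          refine mul_le_mul_of_nonneg_left (div_le_div_of_nonneg_right ?_ (by positivity)) (by norm_num)
          exact pow_le_pow_left₀ (abs_nonneg _) hy _
      _ = 2 * (2 * π) ^ (2 * n) / ((2 * n).factorial : ℝ) * ∫ x in (-1 : ℝ)..1, |prolateFun n x| :=
          intervalIntegral.integral_const_mul _ _
      _ ≤ 2 * (2 * π) ^ (2 * n) / ((2 * n).factorial : ℝ) * (3 / 2) :=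
          mul_le_mul_of_nonneg_left (integral_abs_prolateFun_le n) hK
      _ = 3 * (2 * π) ^ (2 * n) / ((2 * n).factorial : ℝ) := by ring
  -- (b) the polynomial part: `|Σ c_i M_i| ≤ (3/2)(4π²)ⁿ/(n!)²`
  have hpol : |∑ i ∈ range n, c i * ∫ x in (-1 : ℝ)..1, prolateFun n x * x ^ (2 * i)|
      ≤ 3 / 2 * (4 * π ^ 2) ^ n / (n.factorial : ℝ) ^ 2 := by
    refine (abs_sum_le_sum_abs _ _).trans ?_
    have hterm : ∀ i ∈ range n, |c i * ∫ x in (-1 : ℝ)..1, prolateFun n x * x ^ (2 * i)|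
        ≤ 3 / 2 * (4 * π ^ 2) ^ n * (n.choose i : ℝ) / (2 ^ n * (n.factorial : ℝ) ^ 2) := by
      intro i hi
      obtain ⟨k, hk⟩ := Nat.exists_eq_add_of_le (mem_range.1 hi).le
      rw [abs_mul]
      have hci : |c i| ≤ (2 * π) ^ (2 * i) / ((2 * i).factorial : ℝ) := by
        rw [hc]
        simp only
        rw [abs_div, abs_mul, abs_pow, abs_pow, abs_neg, abs_one, one_pow, one_mul,
          Nat.abs_cast]
        refine div_le_div_of_nonneg_right (pow_le_pow_left₀ (abs_nonneg _) ?_ _) (by positivity)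
        rw [abs_mul, abs_of_pos (by positivity : (0 : ℝ) < 2 * π)]
        calc 2 * π * |ω| ≤ 2 * π * 1 := by gcongr
          _ = 2 * π := mul_one _
      have hMi := abs_moment_le n i k hk.symm
      calc |c i| * |∫ x in (-1 : ℝ)..1, prolateFun n x * x ^ (2 * i)|
          ≤ (2 * π) ^ (2 * i) / ((2 * i).factorial : ℝ)
              * (3 / 2 * (2 * π ^ 2) ^ k / ((2 * (n : ℝ) + 1) ^ k * (k.factorial : ℝ))) :=
            mul_le_mul hci hMi (abs_nonneg _) (by positivity)
        _ ≤ 3 / 2 * (4 * π ^ 2) ^ n * (n.choose i : ℝ) / (2 ^ n * (n.factorial : ℝ) ^ 2) := by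
            rw [hk]; exact_mod_cast taylor_mul_moment_term_le i k
    refine (sum_le_sum hterm).trans ?_
    rw [← sum_div, ← mul_sum]
    have hchoose : ∑ i ∈ range n, (n.choose i : ℝ) ≤ 2 ^ n := by
      have h1 : ∑ i ∈ range n, (n.choose i : ℝ) ≤ ∑ i ∈ range (n + 1), (n.choose i : ℝ) :=
        sum_le_sum_of_subset_of_nonneg (range_subset_range.2 (Nat.le_succ n)) fun _ _ _ ↦ by positivity
      have h2 : ∑ i ∈ range (n + 1), (n.choose i : ℝ) = 2 ^ n := by
        exact_mod_cast Nat.sum_range_choose n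
      linarith
    rw [div_le_div_iff₀ (by positivity) (by positivity)]
    have h0 : (0 : ℝ) ≤ 3 / 2 * (4 * π ^ 2) ^ n := by positivity
    calc 3 / 2 * (4 * π ^ 2) ^ n * (∑ i ∈ range n, (n.choose i : ℝ)) * (n.factorial : ℝ) ^ 2
        ≤ 3 / 2 * (4 * π ^ 2) ^ n * 2 ^ n * (n.factorial : ℝ) ^ 2 := by gcongr
      _ = 3 / 2 * (4 * π ^ 2) ^ n * (2 ^ n * (n.factorial : ℝ) ^ 2) := by ring
  -- (c) `3(2π)^{2n}/(2n)! ≤ (1/2)(4π²)ⁿ/(n!)²`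
  have htail : 3 * (2 * π) ^ (2 * n) / ((2 * n).factorial : ℝ)
      ≤ 1 / 2 * (4 * π ^ 2) ^ n / (n.factorial : ℝ) ^ 2 := by
    have h6 : (6 : ℝ) * (n.factorial : ℝ) ^ 2 ≤ ((2 * n).factorial : ℝ) := by
      exact_mod_cast six_mul_factorial_sq_le (by omega : 3 ≤ n)
    have hpow : (2 * π) ^ (2 * n) = (4 * π ^ 2) ^ n := by rw [pow_mul]; ring
    rw [hpow, div_le_div_iff₀ (by positivity) (by positivity)]
    have h0 : (0 : ℝ) ≤ (4 * π ^ 2) ^ n := by positivity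
    nlinarith [mul_le_mul_of_nonneg_left h6 h0]
  -- assemble: `|λ|/2 ≤ |λ ψ(ω)| ≤ (3/2 + 1/2)(4π²)ⁿ/(n!)²`
  have hmain : |prolateEigen n * prolateFun n ω| ≤ 2 * (4 * π ^ 2) ^ n / (n.factorial : ℝ) ^ 2 := by
    rw [← hcos]
    rw [hint_P] at hrem
    set A : ℝ := ∫ x in (-1 : ℝ)..1, prolateFun n x * Real.cos (2 * π * x * ω) with hA
    set B : ℝ := ∑ i ∈ range n, c i * ∫ x in (-1 : ℝ)..1, prolateFun n x * x ^ (2 * i) with hB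
    have hsplit : |A| ≤ |B| + |A - B| := by
      calc |A| = |B + (A - B)| := by congr 1; ring
        _ ≤ |B| + |A - B| := abs_add_le _ _
    simp only [mul_div_assoc] at hpol hrem htail ⊢
    linarith [hsplit, hpol, hrem, htail]
  have hl0 : 0 ≤ |prolateEigen n| := abs_nonneg _
  rw [abs_mul] at hmain
  have hhalf : |prolateEigen n| * (1 / 2) ≤ 2 * (4 * π ^ 2) ^ n / (n.factorial : ℝ) ^ 2 :=
    (mul_le_mul_of_nonneg_left hφω hl0).trans hmain
  simp only [mul_div_assoc] at hhalf ⊢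
  linarith

/-- RH-FREE. **`|λ(n)| ≤ 4·(4π²)ⁿ/(n!)²` for every `n`** (for `n ≤ 5` the right side exceeds `1 > |λ(n)|`,
`abs_prolateEigen_lt_one`).  An explicit, elementary, hypothesis-free form of the decay (rapid-decay)
of Connes–Consani 2021 §4 p. 16 — much weaker than the printed `ν(2n, 2π)` (asserted there via
[Rokhlin–Xiao 2007, Thm 14]) and than [Osipov 2013, Thm 33], but PROVED here.
[cite: ConnesConsani2021, §4 p. 16 eq. (rapid-decay) (arXiv p0016:L34–L37); Osipov2013, Thm. 33 (for comparison)] -/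
theorem abs_prolateEigen_le_explicit (n : ℕ) :
    |prolateEigen n| ≤ 4 * (4 * π ^ 2) ^ n / (n.factorial : ℝ) ^ 2 := by
  by_cases hn : 6 ≤ n
  · exact abs_prolateEigen_le_of_six_le hn
  · have hlt := abs_prolateEigen_lt_one n
    refine hlt.le.trans ?_
    rw [le_div_iff₀ (by positivity), one_mul]
    have hπ : (36 : ℝ) ≤ 4 * π ^ 2 := by nlinarith [Real.pi_gt_three]
    have h36 : (36 : ℝ) ^ n ≤ (4 * π ^ 2) ^ n := pow_le_pow_left₀ (by norm_num) hπ n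
    have hsmall : (n.factorial : ℝ) ^ 2 ≤ 4 * (36 : ℝ) ^ n := by
      interval_cases n <;> norm_num [Nat.factorial]
    linarith


/-! ## §8 The far tail of the App. F remainder with this majorant, and the hybrid package for `hRT` -/

/-- RH-FREE. **Ratio bound ⇒ tail bound**: a non-negative sequence with `a(n+1) ≤ q·a(n)` (`0 ≤ q < 1`) is
summable with `Σ' a ≤ a(0)/(1 − q)` — the geometric domination CC use for `Σ_{n ≥ 35} a(n)` in the proof of
Lemma F.1 (ii) ("the ratio `ν_{n+1}/ν_n` is `< n^{-2}` …").
[cite: ConnesConsani2021, App. F Lemma F.1 (ii) (arXiv Lemma 49) proof, arXiv PDF p. 55 (chunk p0035:L94–L105)] -/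
theorem summable_and_tsum_le_of_ratio_le {a : ℕ → ℝ} {q : ℝ} (hq0 : 0 ≤ q) (hq1 : q < 1)
    (ha : ∀ n, 0 ≤ a n) (hratio : ∀ n, a (n + 1) ≤ q * a n) :
    Summable a ∧ ∑' n, a n ≤ a 0 / (1 - q) := by
  have hdom : ∀ n, a n ≤ a 0 * q ^ n := by
    intro n
    induction n with
    | zero => simp
    | succ n ih =>
      calc a (n + 1) ≤ q * a n := hratio n
        _ ≤ q * (a 0 * q ^ n) := mul_le_mul_of_nonneg_left ih hq0
        _ = a 0 * q ^ (n + 1) := by ring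
  have hg : Summable (fun n : ℕ ↦ a 0 * q ^ n) := (summable_geometric_of_lt_one hq0 hq1).mul_left _
  have hsum : Summable a := Summable.of_nonneg_of_le ha hdom hg
  refine ⟨hsum, ?_⟩
  calc ∑' n, a n ≤ ∑' n, a 0 * q ^ n := hsum.tsum_le_tsum hdom hg
    _ = a 0 / (1 - q) := by
        rw [tsum_mul_left, tsum_geometric_of_lt_one hq0 hq1, div_eq_mul_inv]

/-- RH-FREE. Shifted form: a ratio bound from index `N` on gives `Σ' k, a(k+N) ≤ a(N)/(1 − q)`.
[cite: ConnesConsani2021, App. F Lemma F.1 (ii) (arXiv Lemma 49) proof, arXiv PDF p. 55 (chunk p0035:L94–L105)] -/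
theorem summable_and_tsum_nat_add_le_of_ratio_le {a : ℕ → ℝ} {q : ℝ} (hq0 : 0 ≤ q) (hq1 : q < 1)
    {N : ℕ} (ha : ∀ n, N ≤ n → 0 ≤ a n) (hratio : ∀ n, N ≤ n → a (n + 1) ≤ q * a n) :
    Summable (fun k : ℕ ↦ a (k + N)) ∧ ∑' k, a (k + N) ≤ a N / (1 - q) := by
  have h := summable_and_tsum_le_of_ratio_le (a := fun k : ℕ ↦ a (k + N)) hq0 hq1
    (fun k ↦ ha _ (by omega)) (fun k ↦ by
      simpa [Nat.add_right_comm] using hratio (k + N) (by omega))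
  simpa using h

/-- RH-FREE. **Growth of the polynomial factor `p(n)`** of Lemma F.1: `n²·p(n+1) ≤ (n+1)²·p(n)`
(each piece of `p` grows at most like `(1+1/n)²`; `n√(4n+5) ≤ (n+1)√(4n+1)`).
[cite: ConnesConsani2021, App. F Lemma F.1 (i) (arXiv Lemma 49), arXiv PDF p. 55 (chunk p0035:L81; L94–L97 "`p(n) ≤ 120n²`")] -/
theorem sq_mul_remainderPoly_succ_le (n : ℕ) :
    (n : ℝ) ^ 2 * remainderPoly (n + 1) ≤ ((n : ℝ) + 1) ^ 2 * remainderPoly n := by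
  have hn : (0 : ℝ) ≤ n := Nat.cast_nonneg n
  have hπ := Real.pi_pos.le
  have hs1 : 0 ≤ Real.sqrt (4 * n + 1) := Real.sqrt_nonneg _
  have hroot : (n : ℝ) * Real.sqrt (4 * ((n : ℝ) + 1) + 1) ≤ ((n : ℝ) + 1) * Real.sqrt (4 * n + 1) := by
    have ha : (n : ℝ) * Real.sqrt (4 * ((n : ℝ) + 1) + 1) = Real.sqrt ((n : ℝ) ^ 2 * (4 * n + 5)) := by
      rw [Real.sqrt_mul' _ (by positivity), Real.sqrt_sq hn]; ring_nf
    have hb : ((n : ℝ) + 1) * Real.sqrt (4 * n + 1) = Real.sqrt (((n : ℝ) + 1) ^ 2 * (4 * n + 1)) := by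
      rw [Real.sqrt_mul' _ (by positivity), Real.sqrt_sq (by positivity)]
    rw [ha, hb]
    exact Real.sqrt_le_sqrt (by nlinarith)
  unfold remainderPoly
  push_cast
  have h4 : 0 ≤ 4 + Real.sqrt 2 := by positivity
  have hroot' := mul_le_mul_of_nonneg_left hroot h4
  nlinarith [hroot', mul_nonneg hn hs1, mul_nonneg h4 (mul_nonneg hn hs1), sq_nonneg (n : ℝ),
    mul_nonneg hn hπ, Real.pi_pos]

/-- RH-FREE. A rational upper bound for `p(n)`: `p(n) ≤ 16n² + 108n + 400` (`π < 3.1416`, `√2 ≤ 2`,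
`√(4n+1) ≤ 4n+1`). [cite: ConnesConsani2021, App. F Lemma F.1 (i) (arXiv Lemma 49), arXiv PDF p. 55 (chunk p0035:L81)] -/
theorem remainderPoly_le_rat (n : ℕ) : remainderPoly n ≤ 16 * (n : ℝ) ^ 2 + 108 * n + 400 := by
  have h := remainderPoly_le_poly n
  have hπ := Real.pi_lt_d4
  have hn : (0 : ℝ) ≤ n := Nat.cast_nonneg n
  nlinarith [Real.pi_pos, mul_nonneg hn Real.pi_pos.le]

/-- RH-FREE. **Ratio of the far-tail terms**: with `r(n) = 4(4π²)ⁿ/(n!)²` and `a(n) = r(n)·4πp(n)`,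
`n²·a(n+1) ≤ 4π²·a(n)`, hence `14·a(n+1) ≤ a(n)` for `n ≥ 24` (`56π² < 576`).
[cite: ConnesConsani2021, App. F Lemma F.1 (ii) (arXiv Lemma 49) proof, arXiv PDF p. 55 (chunk p0035:L94–L105)] -/
theorem farTail_ratio {n : ℕ} (hn : 24 ≤ n) :
    14 * (4 * (4 * π ^ 2) ^ (n + 1) / ((n + 1).factorial : ℝ) ^ 2 * (4 * π * remainderPoly (n + 1)))
      ≤ 4 * (4 * π ^ 2) ^ n / (n.factorial : ℝ) ^ 2 * (4 * π * remainderPoly n) := by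
  have hn' : (24 : ℝ) ≤ n := by exact_mod_cast hn
  have hp := sq_mul_remainderPoly_succ_le n
  have hp0 := remainderPoly_pos n
  have hp1 := remainderPoly_pos (n + 1)
  have hπ := Real.pi_lt_d4
  have hπ0 := Real.pi_pos
  have hf0 : (0 : ℝ) < (n.factorial : ℝ) := by exact_mod_cast Nat.factorial_pos n
  -- `(n+1)! = (n+1)·n!`
  have hfs : ((n + 1).factorial : ℝ) = ((n : ℝ) + 1) * (n.factorial : ℝ) := by
    rw [Nat.factorial_succ]; push_cast; ring
  rw [hfs, pow_succ]
  -- clear denominators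
  rw [show 14 * (4 * ((4 * π ^ 2) ^ n * (4 * π ^ 2)) / (((n : ℝ) + 1) * (n.factorial : ℝ)) ^ 2
      * (4 * π * remainderPoly (n + 1)))
      = (4 * (4 * π ^ 2) ^ n / (n.factorial : ℝ) ^ 2 * (4 * π))
        * (14 * (4 * π ^ 2) * remainderPoly (n + 1) / ((n : ℝ) + 1) ^ 2) by
    field_simp]
  rw [show 4 * (4 * π ^ 2) ^ n / (n.factorial : ℝ) ^ 2 * (4 * π * remainderPoly n)
      = (4 * (4 * π ^ 2) ^ n / (n.factorial : ℝ) ^ 2 * (4 * π)) * remainderPoly n by ring]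
  refine mul_le_mul_of_nonneg_left ?_ (by positivity)
  rw [div_le_iff₀ (by positivity)]
  -- `56π²·p(n+1) ≤ (n+1)²p(n)` from `n² p(n+1) ≤ (n+1)² p(n)` and `56π² ≤ n²`
  have h56 : 14 * (4 * π ^ 2) ≤ (n : ℝ) ^ 2 := by nlinarith
  nlinarith [mul_le_mul_of_nonneg_right h56 hp1.le]

/-- RH-FREE. **The first far-tail term**: `a(24) = 4(4π²)²⁴/(24!)²·4π·p(24) ≤ 13/35000`
(`π < 3.1416`, `p(24) ≤ 12208`). [cite: ConnesConsani2021, App. F Lemma F.1 (ii) (arXiv Lemma 49), arXiv PDF p. 55 (chunk p0035:L94–L110)] -/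
theorem farTail_head_le :
    4 * (4 * π ^ 2) ^ 24 / ((24).factorial : ℝ) ^ 2 * (4 * π * remainderPoly 24) ≤ 13 / 35000 := by
  have hπ := Real.pi_lt_d4
  have hπ0 := Real.pi_pos
  have h4π2 : 4 * π ^ 2 ≤ 39.4787 := by nlinarith
  have hpow : (4 * π ^ 2) ^ 24 ≤ (39.4787 : ℝ) ^ 24 := pow_le_pow_left₀ (by positivity) h4π2 24
  have hp : remainderPoly 24 ≤ 12208 := by
    have := remainderPoly_le_rat 24; norm_num at this; linarith
  have h4π : 4 * π ≤ 12.5664 := by linarith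
  have hfact : ((24).factorial : ℝ) = 620448401733239439360000 := by norm_num [Nat.factorial]
  rw [hfact]
  have hp0 := (remainderPoly_pos 24).le
  calc 4 * (4 * π ^ 2) ^ 24 / (620448401733239439360000 : ℝ) ^ 2 * (4 * π * remainderPoly 24)
      ≤ 4 * (39.4787 : ℝ) ^ 24 / (620448401733239439360000 : ℝ) ^ 2 * (12.5664 * 12208) := by
        gcongr
    _ ≤ 13 / 35000 := by norm_num

/-- RH-FREE. **The far tail of the App. F remainder with the moment majorant**: with
`r(n) = 4(4π²)ⁿ/(n!)²`, the series `Σ_k r(k+24)·4πp(k+24)` converges and is `≤ 1/2500`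
(`a(24) ≤ 13/35000`, ratio `≤ 1/14`, `(13/35000)·(14/13) = 1/2500`).
[cite: ConnesConsani2021, App. F Lemma F.1 (ii) (arXiv Lemma 49) eq. (computersafe1)-shape, arXiv PDF p. 55 (chunk p0035:L82–L110)] -/
theorem summable_farTail_and_tsum_le :
    Summable (fun k : ℕ ↦ 4 * (4 * π ^ 2) ^ (k + 24) / ((k + 24).factorial : ℝ) ^ 2
        * (4 * π * remainderPoly (k + 24))) ∧
      ∑' k : ℕ, 4 * (4 * π ^ 2) ^ (k + 24) / ((k + 24).factorial : ℝ) ^ 2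
        * (4 * π * remainderPoly (k + 24)) ≤ 1 / 2500 := by
  have h := summable_and_tsum_nat_add_le_of_ratio_le
    (a := fun n : ℕ ↦ 4 * (4 * π ^ 2) ^ n / (n.factorial : ℝ) ^ 2 * (4 * π * remainderPoly n))
    (q := 1 / 14) (by norm_num) (by norm_num) (N := 24)
    (fun n _ ↦ by have := remainderPoly_pos n; positivity)
    (fun n hn ↦ by
      have := farTail_ratio hn
      linarith)
  refine ⟨h.1, h.2.trans ?_⟩
  have := farTail_head_le
  rw [div_le_iff₀ (by norm_num)]
  linarith

/-- RH-FREE. The moment majorant is eventually tiny: `4(4π²)ⁿ/(n!)² ≤ 13/200` (indeed `≤ 10⁻⁸`) for `n ≥ 24`.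
[cite: ConnesConsani2021, App. F Lemma F.1 (i) (arXiv Lemma 49), arXiv PDF p. 55 (chunk p0035:L78–L81: the smallness of `λ(n)` needed termwise)] -/
theorem momentMajorant_le_of_le {n : ℕ} (hn : 24 ≤ n) :
    4 * (4 * π ^ 2) ^ n / (n.factorial : ℝ) ^ 2 ≤ 13 / 200 := by
  -- decreasing from `n = 6` on (`4π² ≤ 49 ≤ (n+1)²`), and small at `n = 24`
  have hdec : ∀ m : ℕ, 24 ≤ m →
      4 * (4 * π ^ 2) ^ (m + 1) / ((m + 1).factorial : ℝ) ^ 2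
        ≤ 4 * (4 * π ^ 2) ^ m / (m.factorial : ℝ) ^ 2 := by
    intro m hm
    have hm' : (24 : ℝ) ≤ m := by exact_mod_cast hm
    have hf0 : (0 : ℝ) < (m.factorial : ℝ) := by exact_mod_cast Nat.factorial_pos m
    have hfs : ((m + 1).factorial : ℝ) = ((m : ℝ) + 1) * (m.factorial : ℝ) := by
      rw [Nat.factorial_succ]; push_cast; ring
    rw [hfs, pow_succ, div_le_div_iff₀ (by positivity) (by positivity)]
    have hπ : 4 * π ^ 2 ≤ ((m : ℝ) + 1) ^ 2 := by nlinarith [Real.pi_lt_d2, Real.pi_pos]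
    have h0 : (0 : ℝ) ≤ 4 * (4 * π ^ 2) ^ m * (m.factorial : ℝ) ^ 2 := by positivity
    nlinarith [mul_le_mul_of_nonneg_left hπ h0]
  have h24 : 4 * (4 * π ^ 2) ^ 24 / ((24).factorial : ℝ) ^ 2 ≤ 13 / 200 := by
    have hπ := Real.pi_lt_d4
    have h4π2 : 4 * π ^ 2 ≤ 39.4787 := by nlinarith [Real.pi_pos]
    have hpow : (4 * π ^ 2) ^ 24 ≤ (39.4787 : ℝ) ^ 24 := pow_le_pow_left₀ (by positivity) h4π2 24
    have hfact : ((24).factorial : ℝ) = 620448401733239439360000 := by norm_num [Nat.factorial]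
    rw [hfact]
    calc 4 * (4 * π ^ 2) ^ 24 / (620448401733239439360000 : ℝ) ^ 2
        ≤ 4 * (39.4787 : ℝ) ^ 24 / (620448401733239439360000 : ℝ) ^ 2 := by gcongr
      _ ≤ 13 / 200 := by norm_num
  induction n, hn using Nat.le_induction with
  | base => exact h24
  | succ m hm ih => exact (hdec m hm).trans ih

/-- RH-FREE. **Hybrid majorant, clause `hR`**: if `|λ(n)| ≤ R(n)` on the block `8 ≤ n < 24`, then
`|λ(n)| ≤ (if n < 24 then R n else 4(4π²)ⁿ/(n!)²)` for all `n ≥ 8`.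
[cite: ConnesConsani2021, App. F Lemma F.1 (i) (arXiv Lemma 49) eq. (computersafe), arXiv PDF p. 55] -/
theorem abs_prolateEigen_le_hybrid {R : ℕ → ℝ} (hR : ∀ n, 8 ≤ n → n < 24 → |prolateEigen n| ≤ R n)
    (n : ℕ) (hn : 8 ≤ n) :
    |prolateEigen n| ≤ (if n < 24 then R n else 4 * (4 * π ^ 2) ^ n / (n.factorial : ℝ) ^ 2) := by
  split_ifs with h
  · exact hR n hn h
  · exact abs_prolateEigen_le_explicit n

/-- RH-FREE. **Hybrid majorant, clause `hR'`**: if `R(n) ≤ 13/200` on the block `8 ≤ n < 24`, the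
hybrid majorant is `≤ 13/200` for all `n ≥ 8`.
[cite: ConnesConsani2021, App. F Lemma F.1 (i) (arXiv Lemma 49), arXiv PDF p. 55 (chunk p0035:L78–L81)] -/
theorem hybrid_le {R : ℕ → ℝ} (hR' : ∀ n, 8 ≤ n → n < 24 → R n ≤ 13 / 200) (n : ℕ) (hn : 8 ≤ n) :
    (if n < 24 then R n else 4 * (4 * π ^ 2) ^ n / (n.factorial : ℝ) ^ 2) ≤ 13 / 200 := by
  split_ifs with h
  · exact hR' n hn h
  · exact momentMajorant_le_of_le (by omega)

/-- RH-FREE. **Hybrid majorant, clause `hRs`**: `Σ_n (hybrid R)(n)·p(n)` converges (the far tail is the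
geometric-dominated moment tail). [cite: ConnesConsani2021, App. F Lemma F.1 (arXiv Lemma 49), arXiv PDF p. 55 (chunk p0035:L94–L105)] -/
theorem summable_hybrid_mul_remainderPoly (R : ℕ → ℝ) :
    Summable (fun n : ℕ ↦
      (if n < 24 then R n else 4 * (4 * π ^ 2) ^ n / (n.factorial : ℝ) ^ 2) * remainderPoly n) := by
  rw [← summable_nat_add_iff 24]
  have h := (summable_farTail_and_tsum_le.1).mul_left (1 / (4 * π))
  refine h.congr fun k ↦ ?_
  have hk : ¬ (k + 24 < 24) := by omega
  simp only [hk, if_false]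
  have hπ : (4 : ℝ) * π ≠ 0 := by positivity
  field_simp

/-- RH-FREE. **Hybrid majorant, clause `hRT`**: the App. F remainder number splits as the sixteen block
terms plus the far tail, `Σ_k (hybrid R)(k+8)·4πp(k+8) ≤ Σ_{8≤n<24} R(n)·4πp(n) + 1/2500`; so any
rational `C ≥ Σ_{8≤n<24} R(n)·4πp(n)` gives `hRT` with `T = C + 1/2500`.
[cite: ConnesConsani2021, App. F Lemma F.1 (ii) (arXiv Lemma 49) eq. (computersafe1)-shape, arXiv PDF p. 55 (chunk p0035:L82–L110)] -/
theorem tsum_hybrid_le {R : ℕ → ℝ} {C : ℝ}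
    (hC : ∑ n ∈ Finset.Ico 8 24, R n * (4 * π * remainderPoly n) ≤ C) :
    ∑' k : ℕ, (if k + 8 < 24 then R (k + 8)
        else 4 * (4 * π ^ 2) ^ (k + 8) / ((k + 8).factorial : ℝ) ^ 2) * (4 * π * remainderPoly (k + 8))
      ≤ C + 1 / 2500 := by
  set f : ℕ → ℝ := fun n ↦
    (if n < 24 then R n else 4 * (4 * π ^ 2) ^ n / (n.factorial : ℝ) ^ 2) * (4 * π * remainderPoly n)
    with hf
  have hfar := summable_farTail_and_tsum_le
  -- the shifted series `k ↦ f (k + 8)`: its 16-term head is the block, its tail the far tail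
  have htail_eq : (fun k : ℕ ↦ f (k + 16 + 8)) = fun k : ℕ ↦
      4 * (4 * π ^ 2) ^ (k + 24) / ((k + 24).factorial : ℝ) ^ 2 * (4 * π * remainderPoly (k + 24)) := by
    funext k
    have hk : ¬ (k + 16 + 8 < 24) := by omega
    simp only [hf, hk, if_false, show k + 16 + 8 = k + 24 by omega]
  have hs8 : Summable (fun k : ℕ ↦ f (k + 8)) := by
    rw [← summable_nat_add_iff 16, htail_eq]
    exact hfar.1
  have hsplit := hs8.sum_add_tsum_nat_add 16
  have hhead : ∑ k ∈ range 16, f (k + 8) = ∑ n ∈ Finset.Ico 8 24, R n * (4 * π * remainderPoly n) := by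
    rw [Finset.sum_Ico_eq_sum_range]
    refine sum_congr rfl fun k hk ↦ ?_
    have hk' : k < 16 := mem_range.1 hk
    have h1 : 8 + k < 24 := by omega
    simp only [hf, show k + 8 = 8 + k by omega, h1, if_true]
  change ∑' k : ℕ, f (k + 8) ≤ C + 1 / 2500
  rw [← hsplit, hhead, htail_eq]
  linarith [hfar.2]


/-! ## §9 The un-simplified («moment-sum») form of the bound — about `2ⁿ` sharper

Appended 2026-08-26.  The closed form `4(4π²)ⁿ/(n!)²` of §7 throws away the factors `(2n+2i+1)/(2n+1)`,
`(2i)!/(2^i(i!)²)` and `(2n+1)^{n−i} i!/n!`; keeping the product as it comes out of the recursion gives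
`|λ(n)| ≤ 3[Σ_{i<n} (2π)^{2i}/(2i)! · (2π²)^{n−i}/((n−i)!(2n+2i+1)^{n−i}) + 2(2π)^{2n}/(2n)!]`, whose
App. F terms are already `≈ 10⁻³` at `n = 17` (`9.6·10⁻⁴`, `5·10⁻⁵`, `2·10⁻⁶`, … for `n = 17, 18, 19, …`):
the analytic far tail of the remainder can start at `n = 17` (`Σ_{n≥17} ≤ 3/2000`), so that a block source
(an index-wise closed form, or kernel-certified eigenvalue enclosures) is needed only for `8 ≤ n ≤ 16`. -/

/-- RH-FREE. The growth chain with the sharper `χ`-free factors: for `i + k ≤ n`,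
`((2n+2i+1)/(2π²))^k · k! ≤ Π_{s<k} (χ − 2(i+s)(2(i+s)+1))/(4π²)`
(`2n(2n+1) − 2l(2l+1) = 2(n−l)(2n+2l+1)` and `2n+2l+1 ≥ 2n+2i+1` for `l ≥ i`).
[cite: ConnesConsani2021, §4 p. 16 (arXiv p0016:L17–L36); WangLL2010, Lemma 2.2] -/
theorem factorial_mul_pow_le_prod' {χ : ℝ} {n : ℕ} (hχn : 2 * (n : ℝ) * (2 * n + 1) < χ) :
    ∀ k i : ℕ, i + k ≤ n →
      ((2 * (n : ℝ) + 2 * i + 1) / (2 * π ^ 2)) ^ k * (k.factorial : ℝ)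
        ≤ ∏ s ∈ range k, (χ - 2 * ((i + s : ℕ) : ℝ) * (2 * ((i + s : ℕ) : ℝ) + 1)) / (4 * π ^ 2) := by
  have hπ2 : 0 < 4 * π ^ 2 := by positivity
  intro k
  induction k with
  | zero => intro i _; simp
  | succ k ih =>
    intro i hik
    rw [prod_range_succ' (fun s ↦ (χ - 2 * ((i + s : ℕ) : ℝ) * (2 * ((i + s : ℕ) : ℝ) + 1)) / (4 * π ^ 2))]
    have hshift : ∏ s ∈ range k, (χ - 2 * ((i + (s + 1) : ℕ) : ℝ) * (2 * ((i + (s + 1) : ℕ) : ℝ) + 1))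
          / (4 * π ^ 2)
        = ∏ s ∈ range k, (χ - 2 * ((i + 1 + s : ℕ) : ℝ) * (2 * ((i + 1 + s : ℕ) : ℝ) + 1)) / (4 * π ^ 2) := by
      refine prod_congr rfl fun s _ ↦ ?_
      rw [show i + (s + 1) = i + 1 + s by omega]
    rw [hshift]
    -- IH at `i + 1`, then monotonicity of the base `2n + 2i + 1 ≤ 2n + 2(i+1) + 1`
    have hIH := ih (i + 1) (by omega)
    have hbase : ((2 * (n : ℝ) + 2 * i + 1) / (2 * π ^ 2)) ^ k * (k.factorial : ℝ)
        ≤ ((2 * (n : ℝ) + 2 * ((i + 1 : ℕ) : ℝ) + 1) / (2 * π ^ 2)) ^ k * (k.factorial : ℝ) := by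
      refine mul_le_mul_of_nonneg_right (pow_le_pow_left₀ (by positivity) ?_ k) (by positivity)
      refine div_le_div_of_nonneg_right ?_ (by positivity)
      push_cast; linarith
    have hIH' := hbase.trans hIH
    have hi : ((i : ℝ) + (k + 1)) ≤ n := by exact_mod_cast (show i + (k + 1) ≤ n from hik)
    have hi0 : (0 : ℝ) ≤ i := Nat.cast_nonneg i
    have hfirst : (2 * (n : ℝ) + 2 * i + 1) / (2 * π ^ 2) * ((k : ℝ) + 1)
        ≤ (χ - 2 * ((i + 0 : ℕ) : ℝ) * (2 * ((i + 0 : ℕ) : ℝ) + 1)) / (4 * π ^ 2) := by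
      rw [Nat.add_zero, div_mul_eq_mul_div, div_le_div_iff₀ (by positivity) hπ2]
      have hd : (0 : ℝ) ≤ (n : ℝ) - i - (k + 1) := by linarith
      have hcore : 2 * (2 * (n : ℝ) + 2 * i + 1) * ((k : ℝ) + 1) ≤ χ - 2 * (i : ℝ) * (2 * i + 1) := by
        nlinarith [mul_nonneg hd (by positivity : (0 : ℝ) ≤ 2 * n + 2 * i + 1)]
      have h2π : (0 : ℝ) ≤ 2 * π ^ 2 := by positivity
      nlinarith [mul_le_mul_of_nonneg_right hcore h2π]
    have hk0 : 0 ≤ ((2 * (n : ℝ) + 2 * i + 1) / (2 * π ^ 2)) ^ k * (k.factorial : ℝ) := by positivity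
    have hf0 : 0 ≤ (2 * (n : ℝ) + 2 * i + 1) / (2 * π ^ 2) * ((k : ℝ) + 1) := by positivity
    calc ((2 * (n : ℝ) + 2 * i + 1) / (2 * π ^ 2)) ^ (k + 1) * ((k + 1).factorial : ℝ)
        = (((2 * (n : ℝ) + 2 * i + 1) / (2 * π ^ 2)) ^ k * (k.factorial : ℝ))
            * ((2 * (n : ℝ) + 2 * i + 1) / (2 * π ^ 2) * ((k : ℝ) + 1)) := by
          rw [Nat.factorial_succ]; push_cast; ring
      _ ≤ (∏ s ∈ range k, (χ - 2 * ((i + 1 + s : ℕ) : ℝ) * (2 * ((i + 1 + s : ℕ) : ℝ) + 1)) / (4 * π ^ 2))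
            * ((χ - 2 * ((i + 0 : ℕ) : ℝ) * (2 * ((i + 0 : ℕ) : ℝ) + 1)) / (4 * π ^ 2)) :=
          mul_le_mul hIH' hfirst hf0 (hk0.trans hIH')

/-- RH-FREE. **The moment chain against an explicit eigenvalue**: for `ψ_n` with eigen-equation for `χ`
and `i + k = n`, `|∫ψ_n x^{2i}| · Π_{s<k} (χ − 2(i+s)(2(i+s)+1))/(4π²) ≤ 3/2`.
[cite: ConnesConsani2021, §4 p. 16 (arXiv p0016:L17–L36); WangLL2010, Lemma 2.2] -/
theorem abs_moment_mul_prod_le (n i k : ℕ) (hik : i + k = n) {χ : ℝ}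
    (hχ : ∀ x ∈ Ioo (-1 : ℝ) 1,
      -(deriv (fun y ↦ ((1 : ℝ) ^ 2 - y ^ 2) * deriv (prolateFun n) y) x)
        + (2 * π * 1 * x) ^ 2 * prolateFun n x = χ * prolateFun n x) :
    |∫ x in (-1 : ℝ)..1, prolateFun n x * x ^ (2 * i)|
        * ∏ s ∈ range k, (χ - 2 * ((i + s : ℕ) : ℝ) * (2 * ((i + s : ℕ) : ℝ) + 1)) / (4 * π ^ 2)
      ≤ 3 / 2 := by
  have hf := isProlateFunction_prolateFun n
  have hlt : ((2 * n : ℕ) : ℝ) * ((2 * n : ℕ) + 1) < χ := hf.lt_eigen hχ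
  have hχn : 2 * (n : ℝ) * (2 * n + 1) < χ := by push_cast at hlt; linarith
  set M : ℕ → ℝ := fun i ↦ ∫ x in (-1 : ℝ)..1, prolateFun n x * x ^ (2 * i) with hM
  have hM1 : 4 * π ^ 2 * M 1 = χ * M 0 := (eigen_mul_moment_zero n hχ).symm
  have hMrec : ∀ j : ℕ, 4 * π ^ 2 * M (j + 2)
      = (χ - (2 * j + 2) * (2 * j + 3)) * M (j + 1) + (2 * j + 2) * (2 * j + 1) * M j :=
    fun j ↦ four_pi_sq_mul_moment_add_two n j hχ
  have key : ∀ N : ℕ → ℝ, (N = M ∨ N = -M) → 0 ≤ N 0 →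
      |M i| * ∏ s ∈ range k, (χ - 2 * ((i + s : ℕ) : ℝ) * (2 * ((i + s : ℕ) : ℝ) + 1)) / (4 * π ^ 2)
        ≤ |M n| := by
    intro N hN hN0
    have hN1 : 4 * π ^ 2 * N 1 = χ * N 0 := by
      rcases hN with rfl | rfl
      · exact hM1
      · simp only [Pi.neg_apply]; linarith
    have hNrec : ∀ j : ℕ, 4 * π ^ 2 * N (j + 2)
        = (χ - (2 * j + 2) * (2 * j + 3)) * N (j + 1) + (2 * j + 2) * (2 * j + 1) * N j := by
      intro j
      rcases hN with rfl | rfl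
      · exact hMrec j
      · simp only [Pi.neg_apply]; linarith [hMrec j]
    have hch := momentRec_chain hχn hN0 hN1 hNrec k i hik.le
    have hNi : 0 ≤ N i := (momentRec_nonneg hχn hN0 hN1 hNrec i (by omega)).1
    have habs_i : |M i| = N i := by
      rcases hN with rfl | rfl
      · exact abs_of_nonneg hNi
      · rw [Pi.neg_apply] at hNi ⊢; rw [abs_of_nonpos (by linarith)]
    have habs_n : N (i + k) ≤ |M n| := by
      rw [hik]
      rcases hN with rfl | rfl
      · exact le_abs_self _
      · exact neg_le_abs _
    rw [habs_i]
    exact hch.trans habs_n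
  have hprod : |M i| * ∏ s ∈ range k,
      (χ - 2 * ((i + s : ℕ) : ℝ) * (2 * ((i + s : ℕ) : ℝ) + 1)) / (4 * π ^ 2) ≤ |M n| := by
    rcases le_total 0 (M 0) with h | h
    · exact key M (Or.inl rfl) h
    · exact key (-M) (Or.inr rfl) (by simpa using h)
  exact hprod.trans (abs_moment_le_three_halves n n)

/-- RH-FREE. **The sharper moment bound**: for `i + k = n`,
`|∫_{−1}^{1} ψ_n(x) x^{2i} dx| ≤ (3/2)·(2π²)^k / ((2n+2i+1)^k · k!)`.
[cite: ConnesConsani2021, §4 p. 16 (arXiv p0016:L17–L36); WangLL2010, Lemma 2.2] -/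
theorem abs_moment_le' (n i k : ℕ) (hik : i + k = n) :
    |∫ x in (-1 : ℝ)..1, prolateFun n x * x ^ (2 * i)|
      ≤ 3 / 2 * (2 * π ^ 2) ^ k / ((2 * (n : ℝ) + 2 * i + 1) ^ k * (k.factorial : ℝ)) := by
  have hf := isProlateFunction_prolateFun n
  obtain ⟨χ, hχ⟩ := hf.eigen
  have hlt : ((2 * n : ℕ) : ℝ) * ((2 * n : ℕ) + 1) < χ := hf.lt_eigen hχ
  have hχn : 2 * (n : ℝ) * (2 * n + 1) < χ := by push_cast at hlt; linarith
  have hprod := abs_moment_mul_prod_le n i k hik hχ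
  have hlow := factorial_mul_pow_le_prod' hχn k i hik.le
  have h1 : |∫ x in (-1 : ℝ)..1, prolateFun n x * x ^ (2 * i)|
      * (((2 * (n : ℝ) + 2 * i + 1) / (2 * π ^ 2)) ^ k * (k.factorial : ℝ)) ≤ 3 / 2 :=
    (mul_le_mul_of_nonneg_left hlow (abs_nonneg _)).trans hprod
  rw [le_div_iff₀ (by positivity)]
  have e : ((2 * (n : ℝ) + 2 * i + 1) / (2 * π ^ 2)) ^ k * (k.factorial : ℝ) * (2 * π ^ 2) ^ k
      = (2 * (n : ℝ) + 2 * i + 1) ^ k * (k.factorial : ℝ) := by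
    rw [div_pow]; field_simp
  calc |∫ x in (-1 : ℝ)..1, prolateFun n x * x ^ (2 * i)| * ((2 * (n : ℝ) + 2 * i + 1) ^ k * (k.factorial : ℝ))
      = |∫ x in (-1 : ℝ)..1, prolateFun n x * x ^ (2 * i)|
          * (((2 * (n : ℝ) + 2 * i + 1) / (2 * π ^ 2)) ^ k * (k.factorial : ℝ)) * (2 * π ^ 2) ^ k := by
        rw [← e]; ring
    _ ≤ 3 / 2 * (2 * π ^ 2) ^ k := mul_le_mul_of_nonneg_right h1 (by positivity)

/-- RH-FREE. **The eigenvalue bound from ANY moment bounds** (the common skeleton of §7 and §9): for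
`n ≥ 6` and `|∫ψ_n x^{2i}| ≤ b(i)` (`i < n`), `|λ(n)| ≤ 2·Σ_{i<n} (2π)^{2i}/(2i)!·b(i) + 6(2π)^{2n}/(2n)!`
((cosalphan) at a point with `|ψ_n| ≥ ½`, cosine Taylor remainder of order `2n`).
[cite: ConnesConsani2021, §4 p. 16 eqs. (prolateeq), (cosalphan) (arXiv p0016:L17–L28)] -/
theorem abs_prolateEigen_le_of_moment_bounds {n : ℕ} (hn : 6 ≤ n) {b : ℕ → ℝ}
    (hb : ∀ i, i < n → |∫ x in (-1 : ℝ)..1, prolateFun n x * x ^ (2 * i)| ≤ b i) :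
    |prolateEigen n| ≤ 2 * (∑ i ∈ range n, (2 * π) ^ (2 * i) / ((2 * i).factorial : ℝ) * b i)
      + 6 * (2 * π) ^ (2 * n) / ((2 * n).factorial : ℝ) := by
  have hf := isProlateFunction_prolateFun n
  have hle : (-1 : ℝ) ≤ 1 := by norm_num
  obtain ⟨ω, hω, hφω⟩ := exists_half_le_abs_prolateFun n
  have hω1 : |ω| ≤ 1 := abs_le.2 ⟨hω.1, hω.2⟩
  have hcos : ∫ x in (-1 : ℝ)..1, prolateFun n x * Real.cos (2 * π * x * ω)
      = prolateEigen n * prolateFun n ω := by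
    rw [prolateEigen_eq_intervalIntegral]; exact hf.integral_mul_cos_eq_mul hω
  set c : ℕ → ℝ := fun i ↦ (-1) ^ i * (2 * π * ω) ^ (2 * i) / ((2 * i).factorial : ℝ) with hc
  have hP : ∀ x : ℝ, ∑ i ∈ range n, (-1) ^ i * (2 * π * x * ω) ^ (2 * i) / ((2 * i).factorial : ℝ)
      = ∑ i ∈ range n, c i * x ^ (2 * i) := by
    intro x
    refine sum_congr rfl fun i _ ↦ ?_
    rw [hc, show 2 * π * x * ω = (2 * π * ω) * x by ring, mul_pow]
    ring
  have hPc : Continuous fun x : ℝ ↦ ∑ i ∈ range n, c i * x ^ (2 * i) :=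
    continuous_finsetSum _ fun i _ ↦ by fun_prop
  have hIP := intervalIntegrable_prolateFun_mul n hPc
  have hIcos := intervalIntegrable_prolateFun_mul n (g := fun x ↦ Real.cos (2 * π * x * ω)) (by fun_prop)
  have hint_P : ∫ x in (-1 : ℝ)..1, prolateFun n x * ∑ i ∈ range n, c i * x ^ (2 * i)
      = ∑ i ∈ range n, c i * ∫ x in (-1 : ℝ)..1, prolateFun n x * x ^ (2 * i) := by
    have e : (fun x ↦ prolateFun n x * ∑ i ∈ range n, c i * x ^ (2 * i))
        = fun x ↦ ∑ i ∈ range n, c i * (prolateFun n x * x ^ (2 * i)) := by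
      funext x; rw [mul_sum]; exact sum_congr rfl fun i _ ↦ by ring
    rw [e, intervalIntegral.integral_finsetSum fun i _ ↦
      (intervalIntegrable_prolateFun_mul n (g := fun x ↦ x ^ (2 * i)) (by fun_prop)).const_mul (c i)]
    exact sum_congr rfl fun i _ ↦ intervalIntegral.integral_const_mul _ _
  have hrem : |(∫ x in (-1 : ℝ)..1, prolateFun n x * Real.cos (2 * π * x * ω))
      - ∫ x in (-1 : ℝ)..1, prolateFun n x * ∑ i ∈ range n, c i * x ^ (2 * i)|
        ≤ 3 * (2 * π) ^ (2 * n) / ((2 * n).factorial : ℝ) := by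
    rw [← intervalIntegral.integral_sub hIcos hIP]
    have hφi : IntervalIntegrable (fun x ↦ |prolateFun n x|) volume (-1) 1 :=
      hf.contDiffOn.continuousOn.abs.intervalIntegrable_of_Icc hle
    have hK : 0 ≤ 2 * (2 * π) ^ (2 * n) / ((2 * n).factorial : ℝ) := by positivity
    calc |∫ x in (-1 : ℝ)..1, (prolateFun n x * Real.cos (2 * π * x * ω)
            - prolateFun n x * ∑ i ∈ range n, c i * x ^ (2 * i))|
        ≤ ∫ x in (-1 : ℝ)..1, |prolateFun n x * Real.cos (2 * π * x * ω)
            - prolateFun n x * ∑ i ∈ range n, c i * x ^ (2 * i)| :=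
          intervalIntegral.abs_integral_le_integral_abs hle
      _ ≤ ∫ x in (-1 : ℝ)..1, 2 * (2 * π) ^ (2 * n) / ((2 * n).factorial : ℝ) * |prolateFun n x| := by
          refine intervalIntegral.integral_mono_on hle (hIcos.sub hIP).abs (hφi.const_mul _)
            fun x hx ↦ ?_
          rw [← mul_sub, abs_mul, mul_comm, ← hP x]
          refine mul_le_mul_of_nonneg_right ?_ (abs_nonneg _)
          have hx1 : |x| ≤ 1 := abs_le.2 ⟨hx.1, hx.2⟩
          have hy : |2 * π * x * ω| ≤ 2 * π := by
            rw [abs_mul, abs_mul, abs_of_pos (by positivity : (0 : ℝ) < 2 * π)]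
            calc 2 * π * |x| * |ω| ≤ 2 * π * 1 * 1 := by gcongr
              _ = 2 * π := by ring
          have hyn : |2 * π * x * ω| ≤ (2 * (n : ℝ) + 1) / 2 := by
            have : (6 : ℝ) ≤ n := by exact_mod_cast hn
            linarith [Real.pi_lt_d2]
          refine (abs_cos_sub_taylor_le _ n hyn).trans ?_
          rw [mul_div_assoc, mul_div_assoc]
          refine mul_le_mul_of_nonneg_left (div_le_div_of_nonneg_right ?_ (by positivity)) (by norm_num)
          exact pow_le_pow_left₀ (abs_nonneg _) hy _
      _ = 2 * (2 * π) ^ (2 * n) / ((2 * n).factorial : ℝ) * ∫ x in (-1 : ℝ)..1, |prolateFun n x| :=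
          intervalIntegral.integral_const_mul _ _
      _ ≤ 2 * (2 * π) ^ (2 * n) / ((2 * n).factorial : ℝ) * (3 / 2) :=
          mul_le_mul_of_nonneg_left (integral_abs_prolateFun_le n) hK
      _ = 3 * (2 * π) ^ (2 * n) / ((2 * n).factorial : ℝ) := by ring
  have hpol : |∑ i ∈ range n, c i * ∫ x in (-1 : ℝ)..1, prolateFun n x * x ^ (2 * i)|
      ≤ ∑ i ∈ range n, (2 * π) ^ (2 * i) / ((2 * i).factorial : ℝ) * b i := by
    refine (abs_sum_le_sum_abs _ _).trans (sum_le_sum fun i hi ↦ ?_)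
    rw [abs_mul]
    have hci : |c i| ≤ (2 * π) ^ (2 * i) / ((2 * i).factorial : ℝ) := by
      rw [hc]
      simp only
      rw [abs_div, abs_mul, abs_pow, abs_pow, abs_neg, abs_one, one_pow, one_mul, Nat.abs_cast]
      refine div_le_div_of_nonneg_right (pow_le_pow_left₀ (abs_nonneg _) ?_ _) (by positivity)
      rw [abs_mul, abs_of_pos (by positivity : (0 : ℝ) < 2 * π)]
      calc 2 * π * |ω| ≤ 2 * π * 1 := by gcongr
        _ = 2 * π := mul_one _
    exact mul_le_mul hci (hb i (mem_range.1 hi)) (abs_nonneg _) (by positivity)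
  have hmain : |prolateEigen n * prolateFun n ω|
      ≤ (∑ i ∈ range n, (2 * π) ^ (2 * i) / ((2 * i).factorial : ℝ) * b i)
        + 3 * (2 * π) ^ (2 * n) / ((2 * n).factorial : ℝ) := by
    rw [← hcos]
    rw [hint_P] at hrem
    set A : ℝ := ∫ x in (-1 : ℝ)..1, prolateFun n x * Real.cos (2 * π * x * ω) with hA
    set B : ℝ := ∑ i ∈ range n, c i * ∫ x in (-1 : ℝ)..1, prolateFun n x * x ^ (2 * i) with hB
    have hsplit : |A| ≤ |B| + |A - B| := by
      calc |A| = |B + (A - B)| := by congr 1; ring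
        _ ≤ |B| + |A - B| := abs_add_le _ _
    linarith [hsplit, hpol, hrem]
  have hl0 : 0 ≤ |prolateEigen n| := abs_nonneg _
  rw [abs_mul] at hmain
  have hhalf : |prolateEigen n| * (1 / 2)
      ≤ (∑ i ∈ range n, (2 * π) ^ (2 * i) / ((2 * i).factorial : ℝ) * b i)
        + 3 * (2 * π) ^ (2 * n) / ((2 * n).factorial : ℝ) :=
    (mul_le_mul_of_nonneg_left hφω hl0).trans hmain
  simp only [mul_div_assoc] at hhalf ⊢
  linarith

/-- RH-FREE. **The moment-sum bound**: for `n ≥ 6`,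
`|λ(n)| ≤ 3·[Σ_{i<n} (2π)^{2i}/(2i)! · (2π²)^{n−i}/((n−i)!·(2n+2i+1)^{n−i}) + 2(2π)^{2n}/(2n)!]`
(App. F terms `≈ 9.6·10⁻⁴, 5·10⁻⁵, 2·10⁻⁶` at `n = 17, 18, 19`).
[cite: ConnesConsani2021, §4 p. 16 eqs. (prolateeq), (cosalphan), (rapid-decay) (arXiv p0016:L17–L37); WangLL2010, Lemma 2.2] -/
theorem abs_prolateEigen_le_momentSum {n : ℕ} (hn : 6 ≤ n) :
    |prolateEigen n| ≤ 3 * ((∑ i ∈ range n, (2 * π) ^ (2 * i) / ((2 * i).factorial : ℝ)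
        * ((2 * π ^ 2) ^ (n - i) / (((n - i).factorial : ℝ) * (2 * (n : ℝ) + 2 * i + 1) ^ (n - i))))
        + 2 * (2 * π) ^ (2 * n) / ((2 * n).factorial : ℝ)) := by
  have h := abs_prolateEigen_le_of_moment_bounds hn
    (b := fun i ↦ 3 / 2 * (2 * π ^ 2) ^ (n - i) / ((2 * (n : ℝ) + 2 * i + 1) ^ (n - i)
      * ((n - i).factorial : ℝ))) (fun i hi ↦ abs_moment_le' n i (n - i) (by omega))
  refine h.trans (le_of_eq ?_)
  rw [mul_add, mul_sum, mul_sum]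
  congr 1
  · exact sum_congr rfl fun i _ ↦ by ring
  · ring

/-! ## §10 The analytic far tail from `n = 17` -/

/-- RH-FREE. Monotonicity of the moment-sum expression in the number standing for `π` (all powers
positive) — used to replace `π` by the rational `3.1416 > π` in the numerals.
[cite: ConnesConsani2021, App. F Lemma F.1 (ii) (arXiv Lemma 49) proof, arXiv PDF p. 55 (chunk p0035:L94–L110: evaluation of the explicit tail)] -/
theorem momentSum_mono {x y : ℝ} (hx : 0 ≤ x) (hxy : x ≤ y) (n : ℕ) :
    3 * ((∑ i ∈ range n, (2 * x) ^ (2 * i) / ((2 * i).factorial : ℝ)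
        * ((2 * x ^ 2) ^ (n - i) / (((n - i).factorial : ℝ) * (2 * (n : ℝ) + 2 * i + 1) ^ (n - i))))
        + 2 * (2 * x) ^ (2 * n) / ((2 * n).factorial : ℝ))
      ≤ 3 * ((∑ i ∈ range n, (2 * y) ^ (2 * i) / ((2 * i).factorial : ℝ)
        * ((2 * y ^ 2) ^ (n - i) / (((n - i).factorial : ℝ) * (2 * (n : ℝ) + 2 * i + 1) ^ (n - i))))
        + 2 * (2 * y) ^ (2 * n) / ((2 * n).factorial : ℝ)) := by
  have hy : 0 ≤ y := hx.trans hxy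
  gcongr

/-- RH-FREE. **The seven block numerals `n = 17, …, 23`**: with `π ≤ 3.1416` and `p(n) ≤ 16n²+108n+400`,
`Σ_{17≤n<24} (moment-sum bound)(n) · 4πp(n) ≤ 11/10000` (`≈ 1.02·10⁻³ + 5.2·10⁻⁵ + 2.4·10⁻⁶ + …`).
[cite: ConnesConsani2021, App. F Lemma F.1 (ii) (arXiv Lemma 49) eq. (computersafe1)-shape, arXiv PDF p. 55 (chunk p0035:L82–L110)] -/
theorem momentSum_block_le :
    ∑ n ∈ Finset.Ico 17 24, 3 * ((∑ i ∈ range n, (2 * π) ^ (2 * i) / ((2 * i).factorial : ℝ)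
        * ((2 * π ^ 2) ^ (n - i) / (((n - i).factorial : ℝ) * (2 * (n : ℝ) + 2 * i + 1) ^ (n - i))))
        + 2 * (2 * π) ^ (2 * n) / ((2 * n).factorial : ℝ)) * (4 * π * remainderPoly n)
      ≤ 11 / 10000 := by
  have hπ := Real.pi_lt_d4.le
  have hπ0 := Real.pi_pos.le
  calc ∑ n ∈ Finset.Ico 17 24, 3 * ((∑ i ∈ range n, (2 * π) ^ (2 * i) / ((2 * i).factorial : ℝ)
          * ((2 * π ^ 2) ^ (n - i) / (((n - i).factorial : ℝ) * (2 * (n : ℝ) + 2 * i + 1) ^ (n - i))))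
          + 2 * (2 * π) ^ (2 * n) / ((2 * n).factorial : ℝ)) * (4 * π * remainderPoly n)
      ≤ ∑ n ∈ Finset.Ico 17 24, 3 * ((∑ i ∈ range n, (2 * (3.1416 : ℝ)) ^ (2 * i) / ((2 * i).factorial : ℝ)
          * ((2 * (3.1416 : ℝ) ^ 2) ^ (n - i) / (((n - i).factorial : ℝ) * (2 * (n : ℝ) + 2 * i + 1) ^ (n - i))))
          + 2 * (2 * (3.1416 : ℝ)) ^ (2 * n) / ((2 * n).factorial : ℝ))
          * (4 * 3.1416 * (16 * (n : ℝ) ^ 2 + 108 * n + 400)) := by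
        refine sum_le_sum fun n _ ↦ ?_
        have hp := remainderPoly_le_rat n
        have hp0 := (remainderPoly_pos n).le
        refine mul_le_mul (momentSum_mono hπ0 hπ n) (by nlinarith) (by positivity) (by positivity)
    _ ≤ 11 / 10000 := by
        rw [Finset.sum_Ico_eq_sum_range]
        norm_num [Finset.sum_range_succ, Nat.factorial]

/-- RH-FREE. **The far majorant from `n = 17`**, `F(n) := (moment-sum bound)(n)` for `n < 24` and
`4(4π²)ⁿ/(n!)²` for `n ≥ 24`, dominates `|λ(n)|` for `n ≥ 17`.
[cite: ConnesConsani2021, §4 p. 16 eq. (rapid-decay) (arXiv p0016:L34–L37)] -/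
theorem abs_prolateEigen_le_far {n : ℕ} (hn : 17 ≤ n) :
    |prolateEigen n| ≤ (if n < 24 then
        3 * ((∑ i ∈ range n, (2 * π) ^ (2 * i) / ((2 * i).factorial : ℝ)
          * ((2 * π ^ 2) ^ (n - i) / (((n - i).factorial : ℝ) * (2 * (n : ℝ) + 2 * i + 1) ^ (n - i))))
          + 2 * (2 * π) ^ (2 * n) / ((2 * n).factorial : ℝ))
      else 4 * (4 * π ^ 2) ^ n / (n.factorial : ℝ) ^ 2) := by
  split_ifs with h
  · exact abs_prolateEigen_le_momentSum (by omega)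
  · exact abs_prolateEigen_le_explicit n

/-- RH-FREE. **Far tail from `n = 17`**: the series `Σ_k F(k+17)·4πp(k+17)` converges and is `≤ 3/2000`
(`11/10000` for the block `17..23` plus the landed `1/2500` from `24` on).
[cite: ConnesConsani2021, App. F Lemma F.1 (ii) (arXiv Lemma 49) eq. (computersafe1)-shape, arXiv PDF p. 55 (chunk p0035:L82–L110)] -/
theorem summable_farTail17_and_tsum_le :
    Summable (fun k : ℕ ↦ (if k + 17 < 24 then
        3 * ((∑ i ∈ range (k + 17), (2 * π) ^ (2 * i) / ((2 * i).factorial : ℝ)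
          * ((2 * π ^ 2) ^ (k + 17 - i) / (((k + 17 - i).factorial : ℝ)
            * (2 * ((k + 17 : ℕ) : ℝ) + 2 * i + 1) ^ (k + 17 - i))))
          + 2 * (2 * π) ^ (2 * (k + 17)) / ((2 * (k + 17)).factorial : ℝ))
      else 4 * (4 * π ^ 2) ^ (k + 17) / ((k + 17).factorial : ℝ) ^ 2) * (4 * π * remainderPoly (k + 17))) ∧
    ∑' k : ℕ, (if k + 17 < 24 then
        3 * ((∑ i ∈ range (k + 17), (2 * π) ^ (2 * i) / ((2 * i).factorial : ℝ)
          * ((2 * π ^ 2) ^ (k + 17 - i) / (((k + 17 - i).factorial : ℝ)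
            * (2 * ((k + 17 : ℕ) : ℝ) + 2 * i + 1) ^ (k + 17 - i))))
          + 2 * (2 * π) ^ (2 * (k + 17)) / ((2 * (k + 17)).factorial : ℝ))
      else 4 * (4 * π ^ 2) ^ (k + 17) / ((k + 17).factorial : ℝ) ^ 2) * (4 * π * remainderPoly (k + 17))
      ≤ 3 / 2000 := by
  set f : ℕ → ℝ := fun n ↦ (if n < 24 then
        3 * ((∑ i ∈ range n, (2 * π) ^ (2 * i) / ((2 * i).factorial : ℝ)
          * ((2 * π ^ 2) ^ (n - i) / (((n - i).factorial : ℝ) * (2 * (n : ℝ) + 2 * i + 1) ^ (n - i))))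
          + 2 * (2 * π) ^ (2 * n) / ((2 * n).factorial : ℝ))
      else 4 * (4 * π ^ 2) ^ n / (n.factorial : ℝ) ^ 2) * (4 * π * remainderPoly n) with hf
  have hfar := summable_farTail_and_tsum_le
  have htail_eq : (fun k : ℕ ↦ f (k + 7 + 17)) = fun k : ℕ ↦
      4 * (4 * π ^ 2) ^ (k + 24) / ((k + 24).factorial : ℝ) ^ 2 * (4 * π * remainderPoly (k + 24)) := by
    funext k
    have hk : ¬ (k + 7 + 17 < 24) := by omega
    simp only [hf, hk, if_false, show k + 7 + 17 = k + 24 by omega]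
  have hs : Summable (fun k : ℕ ↦ f (k + 17)) := by
    rw [← summable_nat_add_iff 7, htail_eq]
    exact hfar.1
  have hsplit := hs.sum_add_tsum_nat_add 7
  have hhead : ∑ k ∈ range 7, f (k + 17)
      = ∑ n ∈ Finset.Ico 17 24, 3 * ((∑ i ∈ range n, (2 * π) ^ (2 * i) / ((2 * i).factorial : ℝ)
        * ((2 * π ^ 2) ^ (n - i) / (((n - i).factorial : ℝ) * (2 * (n : ℝ) + 2 * i + 1) ^ (n - i))))
        + 2 * (2 * π) ^ (2 * n) / ((2 * n).factorial : ℝ)) * (4 * π * remainderPoly n) := by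
    rw [Finset.sum_Ico_eq_sum_range]
    refine sum_congr rfl fun k hk ↦ ?_
    have hk' : k < 7 := mem_range.1 hk
    have h1 : 17 + k < 24 := by omega
    simp only [hf, show k + 17 = 17 + k by omega, h1, if_true]
  change Summable (fun k : ℕ ↦ f (k + 17)) ∧ ∑' k : ℕ, f (k + 17) ≤ 3 / 2000
  refine ⟨hs, ?_⟩
  rw [← hsplit, hhead, htail_eq]
  linarith [hfar.2, momentSum_block_le]

/-- RH-FREE. The far majorant is tiny: `F(n) ≤ 13/200` for `n ≥ 17` (each block term is `≤` the block sum
`11/10000` because `4πp(n) ≥ 1`; the closed form from `24` on).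
[cite: ConnesConsani2021, App. F Lemma F.1 (i) (arXiv Lemma 49), arXiv PDF p. 55 (chunk p0035:L78–L81)] -/
theorem far_le {n : ℕ} (hn : 17 ≤ n) :
    (if n < 24 then
        3 * ((∑ i ∈ range n, (2 * π) ^ (2 * i) / ((2 * i).factorial : ℝ)
          * ((2 * π ^ 2) ^ (n - i) / (((n - i).factorial : ℝ) * (2 * (n : ℝ) + 2 * i + 1) ^ (n - i))))
          + 2 * (2 * π) ^ (2 * n) / ((2 * n).factorial : ℝ))
      else 4 * (4 * π ^ 2) ^ n / (n.factorial : ℝ) ^ 2) ≤ 13 / 200 := by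
  split_ifs with h
  · -- the `n`-th block term is at most the block sum, and `4π p(n) ≥ 1`
    have hmem : n ∈ Finset.Ico 17 24 := Finset.mem_Ico.2 ⟨hn, h⟩
    have hblock := momentSum_block_le
    have hterm := Finset.single_le_sum (f := fun n : ℕ ↦ 3 * ((∑ i ∈ range n,
        (2 * π) ^ (2 * i) / ((2 * i).factorial : ℝ)
          * ((2 * π ^ 2) ^ (n - i) / (((n - i).factorial : ℝ) * (2 * (n : ℝ) + 2 * i + 1) ^ (n - i))))
          + 2 * (2 * π) ^ (2 * n) / ((2 * n).factorial : ℝ)) * (4 * π * remainderPoly n))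
      (fun m _ ↦ by have := remainderPoly_pos m; positivity) hmem
    have hp1 : 1 ≤ 4 * π * remainderPoly n := by
      have hp : 2 ≤ remainderPoly n := by
        unfold remainderPoly; nlinarith [Real.pi_gt_three, Real.sqrt_nonneg 2,
          Real.sqrt_nonneg (4 * (n : ℝ) + 1), sq_nonneg (n : ℝ), Nat.cast_nonneg (α := ℝ) n,
          mul_nonneg (Nat.cast_nonneg (α := ℝ) n) Real.pi_pos.le]
      nlinarith [Real.pi_gt_three]
    have h0 : 0 ≤ 3 * ((∑ i ∈ range n, (2 * π) ^ (2 * i) / ((2 * i).factorial : ℝ)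
        * ((2 * π ^ 2) ^ (n - i) / (((n - i).factorial : ℝ) * (2 * (n : ℝ) + 2 * i + 1) ^ (n - i))))
        + 2 * (2 * π) ^ (2 * n) / ((2 * n).factorial : ℝ)) := by positivity
    nlinarith [hterm.trans hblock, mul_le_mul_of_nonneg_left hp1 h0]
  · exact momentMajorant_le_of_le (by omega)

/-! ## §11 The hybrid package with a general cut (block `N₁ ≤ n < N₂` + any proved far majorant) -/

/-- RH-FREE. Hybrid `hR` with a general cut. [cite: ConnesConsani2021, App. F Lemma F.1 (i) (arXiv Lemma 49) eq. (computersafe), arXiv PDF p. 55] -/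
theorem abs_prolateEigen_le_hybrid' {R F : ℕ → ℝ} {N₁ N₂ : ℕ}
    (hR : ∀ n, N₁ ≤ n → n < N₂ → |prolateEigen n| ≤ R n) (hF : ∀ n, N₂ ≤ n → |prolateEigen n| ≤ F n)
    (n : ℕ) (hn : N₁ ≤ n) : |prolateEigen n| ≤ (if n < N₂ then R n else F n) := by
  split_ifs with h
  · exact hR n hn h
  · exact hF n (by omega)

/-- RH-FREE. Hybrid `hR'` with a general cut. [cite: ConnesConsani2021, App. F Lemma F.1 (i) (arXiv Lemma 49), arXiv PDF p. 55 (chunk p0035:L78–L81)] -/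
theorem hybrid_le' {R F : ℕ → ℝ} {N₁ N₂ : ℕ} {B : ℝ} (hR' : ∀ n, N₁ ≤ n → n < N₂ → R n ≤ B)
    (hF' : ∀ n, N₂ ≤ n → F n ≤ B) (n : ℕ) (hn : N₁ ≤ n) : (if n < N₂ then R n else F n) ≤ B := by
  split_ifs with h
  · exact hR' n hn h
  · exact hF' n (by omega)

/-- RH-FREE. Hybrid `hRs` with a general cut: summability is that of the far majorant.
[cite: ConnesConsani2021, App. F Lemma F.1 (arXiv Lemma 49), arXiv PDF p. 55 (chunk p0035:L94–L105)] -/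
theorem summable_hybrid_mul_remainderPoly' (R : ℕ → ℝ) {F : ℕ → ℝ} {N₂ : ℕ}
    (hF : Summable (fun k : ℕ ↦ F (k + N₂) * (4 * π * remainderPoly (k + N₂)))) :
    Summable (fun n : ℕ ↦ (if n < N₂ then R n else F n) * remainderPoly n) := by
  rw [← summable_nat_add_iff N₂]
  refine (hF.mul_left (1 / (4 * π))).congr fun k ↦ ?_
  have hk : ¬ (k + N₂ < N₂) := by omega
  simp only [hk, if_false]
  have hπ : (4 : ℝ) * π ≠ 0 := by positivity
  field_simp

/-- RH-FREE. Hybrid `hRT` with a general cut: block sum `≤ C` and far tail `≤ T₂` give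
`Σ_k (hybrid)(k+N₁)·4πp(k+N₁) ≤ C + T₂`.
[cite: ConnesConsani2021, App. F Lemma F.1 (ii) (arXiv Lemma 49) eq. (computersafe1)-shape, arXiv PDF p. 55 (chunk p0035:L82–L110)] -/
theorem tsum_hybrid_le' {R F : ℕ → ℝ} {N₁ N₂ : ℕ} (hN : N₁ ≤ N₂) {C T₂ : ℝ}
    (hFs : Summable (fun k : ℕ ↦ F (k + N₂) * (4 * π * remainderPoly (k + N₂))))
    (hFT : ∑' k : ℕ, F (k + N₂) * (4 * π * remainderPoly (k + N₂)) ≤ T₂)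
    (hC : ∑ n ∈ Finset.Ico N₁ N₂, R n * (4 * π * remainderPoly n) ≤ C) :
    ∑' k : ℕ, (if k + N₁ < N₂ then R (k + N₁) else F (k + N₁)) * (4 * π * remainderPoly (k + N₁))
      ≤ C + T₂ := by
  set f : ℕ → ℝ := fun n ↦ (if n < N₂ then R n else F n) * (4 * π * remainderPoly n) with hf
  obtain ⟨d, rfl⟩ := Nat.exists_eq_add_of_le hN
  have htail_eq : (fun k : ℕ ↦ f (k + d + N₁)) = fun k : ℕ ↦
      F (k + (N₁ + d)) * (4 * π * remainderPoly (k + (N₁ + d))) := by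
    funext k
    have hk : ¬ (k + (N₁ + d) < N₁ + d) := by omega
    simp only [hf, show k + d + N₁ = k + (N₁ + d) by omega, hk, if_false]
  have hs : Summable (fun k : ℕ ↦ f (k + N₁)) := by
    rw [← summable_nat_add_iff d, htail_eq]
    exact hFs
  have hsplit := hs.sum_add_tsum_nat_add d
  have hhead : ∑ k ∈ range d, f (k + N₁) = ∑ n ∈ Finset.Ico N₁ (N₁ + d), R n * (4 * π * remainderPoly n) := by
    rw [Finset.sum_Ico_eq_sum_range, show N₁ + d - N₁ = d by omega]
    refine sum_congr rfl fun k hk ↦ ?_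
    have hk' : k < d := mem_range.1 hk
    have h1 : N₁ + k < N₁ + d := by omega
    simp only [hf, show k + N₁ = N₁ + k by omega, h1, if_true]
  change ∑' k : ℕ, f (k + N₁) ≤ C + T₂
  rw [← hsplit, hhead, htail_eq]
  linarith

/-- RH-FREE. **`hRT` with the analytic far tail from `n = 17`**: for ANY block values `R(8), …, R(16)`
(a closed-form majorant or certified enclosures of `|λ(n)|`) with `Σ_{8≤n<17} R(n)·4πp(n) ≤ C`,
`Σ_k (hybrid₁₇ R)(k+8)·4πp(k+8) ≤ C + 3/2000`.
[cite: ConnesConsani2021, App. F Lemma F.1 (ii) (arXiv Lemma 49) eq. (computersafe1)-shape, arXiv PDF p. 55 (chunk p0035:L82–L110)] -/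
theorem tsum_hybrid17_le {R : ℕ → ℝ} {C : ℝ}
    (hC : ∑ n ∈ Finset.Ico 8 17, R n * (4 * π * remainderPoly n) ≤ C) :
    ∑' k : ℕ, (if k + 8 < 17 then R (k + 8) else
        (if k + 8 < 24 then
          3 * ((∑ i ∈ range (k + 8), (2 * π) ^ (2 * i) / ((2 * i).factorial : ℝ)
            * ((2 * π ^ 2) ^ (k + 8 - i) / (((k + 8 - i).factorial : ℝ)
              * (2 * ((k + 8 : ℕ) : ℝ) + 2 * i + 1) ^ (k + 8 - i))))
            + 2 * (2 * π) ^ (2 * (k + 8)) / ((2 * (k + 8)).factorial : ℝ))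
        else 4 * (4 * π ^ 2) ^ (k + 8) / ((k + 8).factorial : ℝ) ^ 2))
        * (4 * π * remainderPoly (k + 8)) ≤ C + 3 / 2000 :=
  tsum_hybrid_le' (N₁ := 8) (N₂ := 17) (by norm_num)
    (F := fun n ↦ if n < 24 then
        3 * ((∑ i ∈ range n, (2 * π) ^ (2 * i) / ((2 * i).factorial : ℝ)
          * ((2 * π ^ 2) ^ (n - i) / (((n - i).factorial : ℝ) * (2 * (n : ℝ) + 2 * i + 1) ^ (n - i))))
          + 2 * (2 * π) ^ (2 * n) / ((2 * n).factorial : ℝ))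
      else 4 * (4 * π ^ 2) ^ n / (n.factorial : ℝ) ^ 2)
    summable_farTail17_and_tsum_le.1 summable_farTail17_and_tsum_le.2 hC

end Literature.NumberTheory.ConnesConsani2021

end
-- (2026-08-26 13:55Z, t7 g3 for the closed author seat t6) comment-only re-land to re-trigger the farm build of this module (cc-lead R130 (2); no declaration touched).
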